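import Summits.CriticalPhenomena.PercolationContinuityZ3.Theorems.Transplant.SkelNegBParamsFaceFloorsX2HA
import Summits.CriticalPhenomena.PercolationContinuityZ3.Theorems.Transplant.SkelNegBParamsFaceFloorsY2HA
import Summits.CriticalPhenomena.PercolationContinuityZ3.Theorems.Transplant.SkelNegBParamsFaceOriginsXTA
import Summits.CriticalPhenomena.PercolationContinuityZ3.Theorems.Transplant.SkelNegBParamsFaceCountsRangeA
import Summits.CriticalPhenomena.PercolationContinuityZ3.Theorems.Transplant.SkelNegBChoiceAllTA
import Summits.CriticalPhenomena.PercolationContinuityZ3.Theorems.Transplant.SkelNegBParamsResidualsAK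
import Summits.CriticalPhenomena.PercolationContinuityZ3.Theorems.Transplant.SkelNegBParamsSlotsSUA
import HarnessLib

/-!
# N1 (the `{±1}` node), (F) column — **THE THREE M3 FLOOR PACKAGES `FloorsS / FloorsD / FloorsT` AT THE (ζ′) K-SLOTS** (`KS.gT 0 KS.gxAK`, `KS.fT 0 KS.fxA`,
# `KS.PR 0 KS.PxFK`, `SUA exAFK mxRA`, bridge index `cK κ`): the hypotheses of hp-8 g36's glue `NegB.faceHoldsRNOFnL_negChoiceAllOTA_AFK` (SkelNeg1FaceHoldsAF,
# F-GLUE-CONSUMER-SHAPE.md §1/§3), VERBATIM, proved from the x-face packages `KS.floorsX_XF?_A` (p3-g12 X2HA p327556) and the y′-face packages `KS.floorsY_YF?_A`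
# (stmt-g17 Y2HA) with the CAPPED witnesses of the lead's 11:24Z ruling (`NrF := fun x du j z => min (NrX …) (600·Kq − 1)`, `N3F := min (N3X …) (200·Kq + 9)`,
# y′ twins; `hcapX/hcapY` by `capY_of_ranges`; under the point binders `min_eq_left` from the per-point ranges `rangesX_XF?` (this file) / `rangesY_YF?` (Y2SA/Y2TA)).
# Choice functions: hop side `σhF du := if 0 ≤ v_L then sgOf du else −sgOf du` (the (L-F1) convention, `KS.hopY_facts`), `qB := qBXF?`, `qB₃ := qB3XA (RA′ 0)`, `qB′ := qBF (cK κ) 0 g f`, `qB₃′ := qB3YA g f (RA′ 0)`,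
# `yLF x du j z := yLXF? (sgOf du)`, `yLF′ x du j z := yLF? (sgOf du) (σhF du)`, counts `NrX/N3X/σTX`, `NrY/N3Y/σTY`. Slot facts used: `eqNumL_of_atQOTA`,
# `clauseL_of_atQOTA`, `clauseP_of_atQOTA` + `bridgeF_adm` + `ℓBF_ge` (cases D/T), `KS.gT_gxAK` (the K-slot unfolding), `hex_exAFK` + `Lp_SUA_eq` (the r-floor),
# `600·Kq ≤ cK κ` (`cK_eq`).  (stmt-g17 2026-08-22; packager pen per lead (g9) 11:24Z.)
builds on p205010 (kernel theorem, internal audit signed; external expert review pending) — nothing in this file uses p205010; NOTHING is claimed about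
the open node `SamePDropOfSkeletonNeg₁`: these are the M3 inputs of the (F) wrapper; the wrapper (`…_AFK`, hp-8) and the node₁ file (p3) are separate files.
Lane `prim-bschramm-*`, seat `prim-bschramm-stmt` (gen 17); helper file (`--supports stmt-CriticalPhenomena-4575 --as helper`).
[cite: KozmaNitzan2024, §4 Lemma 11–12 (pp. 21–25), Theorem 6 (pp. 25–31)] [cite: MartineauTassion2017, §4.3]
-/

noncomputable section

open scoped Classical ENNReal

namespace Summit.CriticalPhenomena.PercolationContinuityZ3.Theorems.Transplant

namespace PlanarSkeletonNeg

namespace NegB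

open MeasureTheory Literature.Probability.Percolation Literature.Probability.LatticeModels SimpleGraph KNCells KNLevels
open Literature.Probability.Percolation.KozmaNitzan
open Literature.Probability.Percolation.KozmaNitzan.Cells (oth sgOf sgOf_sign stepVec_apply_fst)
open ChainPlanar ChainPara
open TwoAxis.Para (modulus)
open SkelConc (Consts)
open Skelφ
open Neg
open Skelφ (oriφ trφ)

namespace KS

section RangesX

variable (κ : Consts) {V : Type} [DecidableEq V] [Countable V] {G : SimpleGraph V} [G.LocallyFinite] (Φ : PlanarSkeletonNeg G) (t : V)
  (p : unitInterval) (D : Skelφ.StepI.DataN V) (c mk : ℕ) (gx fx : Neg.FSlot)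

/-- **The x counts' ranges at the origin `yLXFs`** (per point; what the packager reads for the capped witnesses): `NrX + 1 ≤ 600·Kq`, `N3X + 1 ≤ 200·Kq + 10`. [folklore] -/
theorem rangesX_XFs (hN : EqNumL κ Φ t p D (gT mk gx κ Φ t p D) (fT mk fx κ Φ t p D)) (hκ : (hL κ Φ t p D (gT mk gx κ Φ t p D) (fT mk fx κ Φ t p D)).natAbs ≤ 10 * nL κ Φ t p D (gT mk gx κ Φ t p D) (fT mk fx κ Φ t p D))
    (hS : 16 * SF κ Φ t p D c mk ≤ ML κ Φ t p D (gT mk gx κ Φ t p D))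
    (x : Site 2) (du : MDir) (hd : du.1 = 0) (j : ℕ) (hj : j < (fcellsA κ Φ t p D (gT mk gx κ Φ t p D) (fT mk fx κ Φ t p D)).K) (z : Site 2) {E : ℕ} {kE : ℤ}
    (hlev1 : (fcellsA κ Φ t p D (gT mk gx κ Φ t p D) (fT mk fx κ Φ t p D)).faceL 0 j - E ≤ (fcellsA κ Φ t p D (gT mk gx κ Φ t p D) (fT mk fx κ Φ t p D)).lev du x z)
    (hlev2 : (fcellsA κ Φ t p D (gT mk gx κ Φ t p D) (fT mk fx κ Φ t p D)).lev du x z ≤ (fcellsA κ Φ t p D (gT mk gx κ Φ t p D) (fT mk fx κ Φ t p D)).faceL 0 j + E)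
    (hz : |z 1 - (fcellsA κ Φ t p D (gT mk gx κ Φ t p D) (fT mk fx κ Φ t p D)).cen x 1| ≤ kE) (hEu : (E : ℤ) ≤ u₀A κ Φ t p D (gT mk gx κ Φ t p D) (fT mk fx κ Φ t p D)) (hkE : kE ≤ 5 * ((fcellsA κ Φ t p D (gT mk gx κ Φ t p D) (fT mk fx κ Φ t p D)).r 1 : ℤ)) :
    NrX κ Φ t p D (gT mk gx κ Φ t p D) (fT mk fx κ Φ t p D) (yLXFs κ Φ t p D c mk (gT mk gx κ Φ t p D) (fT mk fx κ Φ t p D) (sgOf du)) (σTX κ Φ t p D (gT mk gx κ Φ t p D) (fT mk fx κ Φ t p D) (yLXFs κ Φ t p D c mk (gT mk gx κ Φ t p D) (fT mk fx κ Φ t p D) (sgOf du)) x z) x du z + 1 ≤ 600 * Neg.Kq κ ∧ N3X κ Φ t p D (gT mk gx κ Φ t p D) (fT mk fx κ Φ t p D) (yLXFs κ Φ t p D c mk (gT mk gx κ Φ t p D) (fT mk fx κ Φ t p D) (sgOf du)) x z + 1 ≤ 200 * Neg.Kq κ + 10 := by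
  have hσ : sgOf du = 1 ∨ sgOf du = -1 := sgOf_sign du
  obtain ⟨hΛ₀, hΛ₁⟩ := Λ_yLXFs κ Φ t p D c mk (fT mk fx κ Φ t p D) gx hN hκ hS hσ
  have hσT : (σTX κ Φ t p D (gT mk gx κ Φ t p D) (fT mk fx κ Φ t p D) (yLXFs κ Φ t p D c mk (gT mk gx κ Φ t p D) (fT mk fx κ Φ t p D) (sgOf du)) x z) = 1 ∨ (σTX κ Φ t p D (gT mk gx κ Φ t p D) (fT mk fx κ Φ t p D) (yLXFs κ Φ t p D c mk (gT mk gx κ Φ t p D) (fT mk fx κ Φ t p D) (sgOf du)) x z) = -1 := by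
    unfold σTX; split_ifs <;> simp
  have he0 := he0_of_Λ₀ κ Φ t p D (gT mk gx κ Φ t p D) (fT mk fx κ Φ t p D) hN (yLXFs κ Φ t p D c mk (gT mk gx κ Φ t p D) (fT mk fx κ Φ t p D) (sgOf du)) hΛ₀ hσT
  have he1 := he1_of_Λ₁ κ Φ t p D (gT mk gx κ Φ t p D) (fT mk fx κ Φ t p D) hN (yLXFs κ Φ t p D c mk (gT mk gx κ Φ t p D) (fT mk fx κ Φ t p D) (sgOf du)) hΛ₁
  have hu0 : 1 ≤ u₀A κ Φ t p D (gT mk gx κ Φ t p D) (fT mk fx κ Φ t p D) := (units_eqA κ Φ t p D (gT mk gx κ Φ t p D) (fT mk fx κ Φ t p D)).2.2.2.2.2.2.1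
  have hu1 : 1 ≤ u₁A κ Φ t p D (gT mk gx κ Φ t p D) (fT mk fx κ Φ t p D) := (units_eqA κ Φ t p D (gT mk gx κ Φ t p D) (fT mk fx κ Φ t p D)).2.2.2.2.2.2.2
  exact ⟨(NrX_range κ Φ t p D (gT mk gx κ Φ t p D) (fT mk fx κ Φ t p D) hN x du hd z hj hlev1 hlev2 (yLXFs κ Φ t p D c mk (gT mk gx κ Φ t p D) (fT mk fx κ Φ t p D) (sgOf du)) _ he0 (by linarith)).2, N3X_range κ Φ t p D (gT mk gx κ Φ t p D) (fT mk fx κ Φ t p D) (yLXFs κ Φ t p D c mk (gT mk gx κ Φ t p D) (fT mk fx κ Φ t p D) (sgOf du)) x z hz hkE he1 (by linarith)⟩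

/-- **The x counts' ranges at the origin `yLXFd`** (per point; what the packager reads for the capped witnesses): `NrX + 1 ≤ 600·Kq`, `N3X + 1 ≤ 200·Kq + 10`. [folklore] -/
theorem rangesX_XFd (hN : EqNumL κ Φ t p D (gT mk gx κ Φ t p D) (fT mk fx κ Φ t p D)) (hκ : (hL κ Φ t p D (gT mk gx κ Φ t p D) (fT mk fx κ Φ t p D)).natAbs ≤ 10 * nL κ Φ t p D (gT mk gx κ Φ t p D) (fT mk fx κ Φ t p D))
    (hS : 16 * SF κ Φ t p D c mk ≤ ML κ Φ t p D (gT mk gx κ Φ t p D)) (hℓb : 27 ≤ ℓBF κ Φ t p D c mk)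
    (x : Site 2) (du : MDir) (hd : du.1 = 0) (j : ℕ) (hj : j < (fcellsA κ Φ t p D (gT mk gx κ Φ t p D) (fT mk fx κ Φ t p D)).K) (z : Site 2) {E : ℕ} {kE : ℤ}
    (hlev1 : (fcellsA κ Φ t p D (gT mk gx κ Φ t p D) (fT mk fx κ Φ t p D)).faceL 0 j - E ≤ (fcellsA κ Φ t p D (gT mk gx κ Φ t p D) (fT mk fx κ Φ t p D)).lev du x z)
    (hlev2 : (fcellsA κ Φ t p D (gT mk gx κ Φ t p D) (fT mk fx κ Φ t p D)).lev du x z ≤ (fcellsA κ Φ t p D (gT mk gx κ Φ t p D) (fT mk fx κ Φ t p D)).faceL 0 j + E)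
    (hz : |z 1 - (fcellsA κ Φ t p D (gT mk gx κ Φ t p D) (fT mk fx κ Φ t p D)).cen x 1| ≤ kE) (hEu : (E : ℤ) ≤ u₀A κ Φ t p D (gT mk gx κ Φ t p D) (fT mk fx κ Φ t p D)) (hkE : kE ≤ 5 * ((fcellsA κ Φ t p D (gT mk gx κ Φ t p D) (fT mk fx κ Φ t p D)).r 1 : ℤ)) :
    NrX κ Φ t p D (gT mk gx κ Φ t p D) (fT mk fx κ Φ t p D) (yLXFd κ Φ t p D c mk (gT mk gx κ Φ t p D) (fT mk fx κ Φ t p D) (sgOf du)) (σTX κ Φ t p D (gT mk gx κ Φ t p D) (fT mk fx κ Φ t p D) (yLXFd κ Φ t p D c mk (gT mk gx κ Φ t p D) (fT mk fx κ Φ t p D) (sgOf du)) x z) x du z + 1 ≤ 600 * Neg.Kq κ ∧ N3X κ Φ t p D (gT mk gx κ Φ t p D) (fT mk fx κ Φ t p D) (yLXFd κ Φ t p D c mk (gT mk gx κ Φ t p D) (fT mk fx κ Φ t p D) (sgOf du)) x z + 1 ≤ 200 * Neg.Kq κ + 10 := by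
  have hσ : sgOf du = 1 ∨ sgOf du = -1 := sgOf_sign du
  obtain ⟨hΛ₀, hΛ₁⟩ := (Λ_XFsdt κ Φ t p D c mk gx fx hN hκ hS hσ hℓb).2.1
  have hσT : (σTX κ Φ t p D (gT mk gx κ Φ t p D) (fT mk fx κ Φ t p D) (yLXFd κ Φ t p D c mk (gT mk gx κ Φ t p D) (fT mk fx κ Φ t p D) (sgOf du)) x z) = 1 ∨ (σTX κ Φ t p D (gT mk gx κ Φ t p D) (fT mk fx κ Φ t p D) (yLXFd κ Φ t p D c mk (gT mk gx κ Φ t p D) (fT mk fx κ Φ t p D) (sgOf du)) x z) = -1 := by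
    unfold σTX; split_ifs <;> simp
  have he0 := he0_of_Λ₀ κ Φ t p D (gT mk gx κ Φ t p D) (fT mk fx κ Φ t p D) hN (yLXFd κ Φ t p D c mk (gT mk gx κ Φ t p D) (fT mk fx κ Φ t p D) (sgOf du)) hΛ₀ hσT
  have he1 := he1_of_Λ₁ κ Φ t p D (gT mk gx κ Φ t p D) (fT mk fx κ Φ t p D) hN (yLXFd κ Φ t p D c mk (gT mk gx κ Φ t p D) (fT mk fx κ Φ t p D) (sgOf du)) hΛ₁
  have hu0 : 1 ≤ u₀A κ Φ t p D (gT mk gx κ Φ t p D) (fT mk fx κ Φ t p D) := (units_eqA κ Φ t p D (gT mk gx κ Φ t p D) (fT mk fx κ Φ t p D)).2.2.2.2.2.2.1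
  have hu1 : 1 ≤ u₁A κ Φ t p D (gT mk gx κ Φ t p D) (fT mk fx κ Φ t p D) := (units_eqA κ Φ t p D (gT mk gx κ Φ t p D) (fT mk fx κ Φ t p D)).2.2.2.2.2.2.2
  exact ⟨(NrX_range κ Φ t p D (gT mk gx κ Φ t p D) (fT mk fx κ Φ t p D) hN x du hd z hj hlev1 hlev2 (yLXFd κ Φ t p D c mk (gT mk gx κ Φ t p D) (fT mk fx κ Φ t p D) (sgOf du)) _ he0 (by linarith)).2, N3X_range κ Φ t p D (gT mk gx κ Φ t p D) (fT mk fx κ Φ t p D) (yLXFd κ Φ t p D c mk (gT mk gx κ Φ t p D) (fT mk fx κ Φ t p D) (sgOf du)) x z hz hkE he1 (by linarith)⟩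

/-- **The x counts' ranges at the origin `yLXFt`** (per point; what the packager reads for the capped witnesses): `NrX + 1 ≤ 600·Kq`, `N3X + 1 ≤ 200·Kq + 10`. [folklore] -/
theorem rangesX_XFt (hN : EqNumL κ Φ t p D (gT mk gx κ Φ t p D) (fT mk fx κ Φ t p D)) (hκ : (hL κ Φ t p D (gT mk gx κ Φ t p D) (fT mk fx κ Φ t p D)).natAbs ≤ 10 * nL κ Φ t p D (gT mk gx κ Φ t p D) (fT mk fx κ Φ t p D))
    (hS : 16 * SF κ Φ t p D c mk ≤ ML κ Φ t p D (gT mk gx κ Φ t p D)) (hℓb : 27 ≤ ℓBF κ Φ t p D c mk)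
    (x : Site 2) (du : MDir) (hd : du.1 = 0) (j : ℕ) (hj : j < (fcellsA κ Φ t p D (gT mk gx κ Φ t p D) (fT mk fx κ Φ t p D)).K) (z : Site 2) {E : ℕ} {kE : ℤ}
    (hlev1 : (fcellsA κ Φ t p D (gT mk gx κ Φ t p D) (fT mk fx κ Φ t p D)).faceL 0 j - E ≤ (fcellsA κ Φ t p D (gT mk gx κ Φ t p D) (fT mk fx κ Φ t p D)).lev du x z)
    (hlev2 : (fcellsA κ Φ t p D (gT mk gx κ Φ t p D) (fT mk fx κ Φ t p D)).lev du x z ≤ (fcellsA κ Φ t p D (gT mk gx κ Φ t p D) (fT mk fx κ Φ t p D)).faceL 0 j + E)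
    (hz : |z 1 - (fcellsA κ Φ t p D (gT mk gx κ Φ t p D) (fT mk fx κ Φ t p D)).cen x 1| ≤ kE) (hEu : (E : ℤ) ≤ u₀A κ Φ t p D (gT mk gx κ Φ t p D) (fT mk fx κ Φ t p D)) (hkE : kE ≤ 5 * ((fcellsA κ Φ t p D (gT mk gx κ Φ t p D) (fT mk fx κ Φ t p D)).r 1 : ℤ)) :
    NrX κ Φ t p D (gT mk gx κ Φ t p D) (fT mk fx κ Φ t p D) (yLXFt κ Φ t p D c mk (gT mk gx κ Φ t p D) (fT mk fx κ Φ t p D) (sgOf du)) (σTX κ Φ t p D (gT mk gx κ Φ t p D) (fT mk fx κ Φ t p D) (yLXFt κ Φ t p D c mk (gT mk gx κ Φ t p D) (fT mk fx κ Φ t p D) (sgOf du)) x z) x du z + 1 ≤ 600 * Neg.Kq κ ∧ N3X κ Φ t p D (gT mk gx κ Φ t p D) (fT mk fx κ Φ t p D) (yLXFt κ Φ t p D c mk (gT mk gx κ Φ t p D) (fT mk fx κ Φ t p D) (sgOf du)) x z + 1 ≤ 200 * Neg.Kq κ + 10 := by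
  have hσ : sgOf du = 1 ∨ sgOf du = -1 := sgOf_sign du
  obtain ⟨hΛ₀, hΛ₁⟩ := (Λ_XFsdt κ Φ t p D c mk gx fx hN hκ hS hσ hℓb).2.2
  have hσT : (σTX κ Φ t p D (gT mk gx κ Φ t p D) (fT mk fx κ Φ t p D) (yLXFt κ Φ t p D c mk (gT mk gx κ Φ t p D) (fT mk fx κ Φ t p D) (sgOf du)) x z) = 1 ∨ (σTX κ Φ t p D (gT mk gx κ Φ t p D) (fT mk fx κ Φ t p D) (yLXFt κ Φ t p D c mk (gT mk gx κ Φ t p D) (fT mk fx κ Φ t p D) (sgOf du)) x z) = -1 := by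
    unfold σTX; split_ifs <;> simp
  have he0 := he0_of_Λ₀ κ Φ t p D (gT mk gx κ Φ t p D) (fT mk fx κ Φ t p D) hN (yLXFt κ Φ t p D c mk (gT mk gx κ Φ t p D) (fT mk fx κ Φ t p D) (sgOf du)) hΛ₀ hσT
  have he1 := he1_of_Λ₁ κ Φ t p D (gT mk gx κ Φ t p D) (fT mk fx κ Φ t p D) hN (yLXFt κ Φ t p D c mk (gT mk gx κ Φ t p D) (fT mk fx κ Φ t p D) (sgOf du)) hΛ₁
  have hu0 : 1 ≤ u₀A κ Φ t p D (gT mk gx κ Φ t p D) (fT mk fx κ Φ t p D) := (units_eqA κ Φ t p D (gT mk gx κ Φ t p D) (fT mk fx κ Φ t p D)).2.2.2.2.2.2.1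
  have hu1 : 1 ≤ u₁A κ Φ t p D (gT mk gx κ Φ t p D) (fT mk fx κ Φ t p D) := (units_eqA κ Φ t p D (gT mk gx κ Φ t p D) (fT mk fx κ Φ t p D)).2.2.2.2.2.2.2
  exact ⟨(NrX_range κ Φ t p D (gT mk gx κ Φ t p D) (fT mk fx κ Φ t p D) hN x du hd z hj hlev1 hlev2 (yLXFt κ Φ t p D c mk (gT mk gx κ Φ t p D) (fT mk fx κ Φ t p D) (sgOf du)) _ he0 (by linarith)).2, N3X_range κ Φ t p D (gT mk gx κ Φ t p D) (fT mk fx κ Φ t p D) (yLXFt κ Φ t p D c mk (gT mk gx κ Φ t p D) (fT mk fx κ Φ t p D) (sgOf du)) x z hz hkE he1 (by linarith)⟩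

end RangesX

end KS

/-! ## The three packages -/

set_option maxHeartbeats 4000000 in
/-- **`FloorsS` at the K-slots** — the same-orientation bridge case (`o_F = o_L`, frames `KS.BFs`): the ∃-package of hp-8's glue, with the capped witnesses. [cite: KozmaNitzan2024, §4 Lemma 11–12 (pp. 21–25), Theorem 6 (pp. 25–31)] -/
theorem floorsPkgS_AK :
    ∀ (κ : Consts) {V : Type} [DecidableEq V] [Countable V] {G : SimpleGraph V} [G.LocallyFinite] (Φ : PlanarSkeletonNeg G) (t : V) (p : unitInterval)
      (hC : Φ.CylSubcritical p) (O : Skelφ.StepI.OutO V) (q : unitInterval),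
      (choiceAtOTA κ Φ t p (KS.gT 0 KS.gxAK) (KS.fT 0 KS.fxA) (SUA exAFK mxRA) hC (KS.PR 0 KS.PxFK)).AtQO O q → Φ.types = {t} → 0 < (p : ℝ) → (p : ℝ) < 1 →
      O.ori t (KS.MBF κ Φ t p O.merged (cK κ) 0) (KS.nBF κ Φ t p O.merged (cK κ) 0) = oL κ Φ t p O.D O.DT O.ori (gOf κ Φ t p O (KS.gT 0 KS.gxAK)) (fOf κ Φ t p O (KS.fT 0 KS.fxA)) →
      ∃ (σhF : MDir → ℤ) (_ : ∀ du : MDir, σhF du = 1 ∨ σhF du = -1) (qB qB₃ qB' qB₃' : ℕ)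
        (yLF : Site 2 → MDir → ℕ → Site 2 → Site 2) (NrF N3F : Site 2 → MDir → ℕ → Site 2 → ℕ) (σTF : Site 2 → MDir → ℕ → Site 2 → ℤ)
        (yLF' : Site 2 → MDir → ℕ → Site 2 → Site 2) (NrF' N3F' : Site 2 → MDir → ℕ → Site 2 → ℕ) (σTF' : Site 2 → MDir → ℕ → Site 2 → ℤ),
        (∀ (x : Site 2) (du : MDir) (j : ℕ) (z : Site 2), du.1 = 0 → j < (fcellsA κ Φ t p O.merged (gOf κ Φ t p O (KS.gT 0 KS.gxAK)) (fOf κ Φ t p O (KS.fT 0 KS.fxA))).K → ((fcellsA κ Φ t p O.merged (gOf κ Φ t p O (KS.gT 0 KS.gxAK)) (fOf κ Φ t p O (KS.fT 0 KS.fxA))).faceL du.1 j : ℤ) - (((KS.RlevA κ Φ t p O.merged 0 + KS.reachA t O.merged 0) : ℕ) : ℤ) ≤ (fcellsA κ Φ t p O.merged (gOf κ Φ t p O (KS.gT 0 KS.gxAK)) (fOf κ Φ t p O (KS.fT 0 KS.fxA))).lev du x z →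
      (fcellsA κ Φ t p O.merged (gOf κ Φ t p O (KS.gT 0 KS.gxAK)) (fOf κ Φ t p O (KS.fT 0 KS.fxA))).lev du x z ≤ (fcellsA κ Φ t p O.merged (gOf κ Φ t p O (KS.gT 0 KS.gxAK)) (fOf κ Φ t p O (KS.fT 0 KS.fxA))).faceL du.1 j + (((KS.RlevA κ Φ t p O.merged 0 + KS.reachA t O.merged 0) : ℕ) : ℤ) → |z (oth du.1) - (fcellsA κ Φ t p O.merged (gOf κ Φ t p O (KS.gT 0 KS.gxAK)) (fOf κ Φ t p O (KS.fT 0 KS.fxA))).cen x (oth du.1)| ≤ ((prFA κ Φ t p O.merged (gOf κ Φ t p O (KS.gT 0 KS.gxAK)) (fOf κ Φ t p O (KS.fT 0 KS.fxA))).kFF₂ (fcellsA κ Φ t p O.merged (gOf κ Φ t p O (KS.gT 0 KS.gxAK)) (fOf κ Φ t p O (KS.fT 0 KS.fxA))) ((KS.RlevA κ Φ t p O.merged 0 + KS.reachA t O.merged 0) - 1) du.1) →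
      Skelφ.FloorsX2 (prFA κ Φ t p O.merged (gOf κ Φ t p O (KS.gT 0 KS.gxAK)) (fOf κ Φ t p O (KS.fT 0 KS.fxA))) (nL κ Φ t p O.merged (gOf κ Φ t p O (KS.gT 0 KS.gxAK)) (fOf κ Φ t p O (KS.fT 0 KS.fxA))) (((fcellsA κ Φ t p O.merged (gOf κ Φ t p O (KS.gT 0 KS.gxAK)) (fOf κ Φ t p O (KS.fT 0 KS.fxA))).s 0 : ℕ) : ℤ) (((fcellsA κ Φ t p O.merged (gOf κ Φ t p O (KS.gT 0 KS.gxAK)) (fOf κ Φ t p O (KS.fT 0 KS.fxA))).s 1 : ℕ) : ℤ) (modulus (nL κ Φ t p O.merged (gOf κ Φ t p O (KS.gT 0 KS.gxAK)) (fOf κ Φ t p O (KS.fT 0 KS.fxA))) (hL κ Φ t p O.merged (gOf κ Φ t p O (KS.gT 0 KS.gxAK)) (fOf κ Φ t p O (KS.fT 0 KS.fxA))) (vL κ Φ t p O.merged (gOf κ Φ t p O (KS.gT 0 KS.gxAK)) (fOf κ Φ t p O (KS.fT 0 KS.fxA))) (vβL κ Φ t p O.merged (gOf κ Φ t p O (KS.gT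 0 KS.gxAK)) (fOf κ Φ t p O (KS.fT 0 KS.fxA)))) (((nL κ Φ t p O.merged (gOf κ Φ t p O (KS.gT 0 KS.gxAK)) (fOf κ Φ t p O (KS.fT 0 KS.fxA))) : ℕ) : ℤ) (ℓL κ Φ t p O.merged (gOf κ Φ t p O (KS.gT 0 KS.gxAK)) (fOf κ Φ t p O (KS.fT 0 KS.fxA))) (fcellsA κ Φ t p O.merged (gOf κ Φ t p O (KS.gT 0 KS.gxAK)) (fOf κ Φ t p O (KS.fT 0 KS.fxA))) (b0TA κ Φ t p O.merged (gOf κ Φ t p O (KS.gT 0 KS.gxAK)) (fOf κ Φ t p O (KS.fT 0 KS.fxA))) x du j (3 : ℤ) (Skelφ.Prm.Lp (SUA exAFK mxRA κ Φ t p O.merged (gOf κ Φ t p O (KS.gT 0 KS.gxAK)) (fOf κ Φ t p O (KS.fT 0 KS.fxA)) q)) (Mu O.merged) z (fun i : Fin 2 => if i = 0 then KS.kF₀A κ Φ t p O.merged (cK κ) 0 (gOf κ Φ t p O (KS.gT 0 KS.gxAK)) (fOf κ Φ t p O (KS.fT 0 KS.fxA)) else KS.kF₁A κ Φ t p O.merged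 (cK κ) 0 (gOf κ Φ t p O (KS.gT 0 KS.gxAK)) (fOf κ Φ t p O (KS.fT 0 KS.fxA))) ((fun σ' : ℤ => KS.BFs κ Φ t p O.merged (cK κ) 0 (gOf κ Φ t p O (KS.gT 0 KS.gxAK)) (fOf κ Φ t p O (KS.fT 0 KS.fxA)) σ') (sgOf du)) (KS.RA' κ Φ t p O.merged 0) qB (KS.RA' κ Φ t p O.merged 0) qB₃ (yLF x du j z) (NrF x du j z) (N3F x du j z) (σTF x du j z)) ∧
        (∀ (x : Site 2) (du : MDir) (j : ℕ) (z : Site 2), du.1 = 1 → j < (fcellsA κ Φ t p O.merged (gOf κ Φ t p O (KS.gT 0 KS.gxAK)) (fOf κ Φ t p O (KS.fT 0 KS.fxA))).K → ((fcellsA κ Φ t p O.merged (gOf κ Φ t p O (KS.gT 0 KS.gxAK)) (fOf κ Φ t p O (KS.fT 0 KS.fxA))).faceL du.1 j : ℤ) - (((KS.RlevA κ Φ t p O.merged 0 + KS.reachA t O.merged 0) : ℕ) : ℤ) ≤ (fcellsA κ Φ t p O.merged (gOf κ Φ t p O (KS.gT 0 KS.gxAK)) (fOf κ Φ t p O (KS.fT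 0 KS.fxA))).lev du x z →
      (fcellsA κ Φ t p O.merged (gOf κ Φ t p O (KS.gT 0 KS.gxAK)) (fOf κ Φ t p O (KS.fT 0 KS.fxA))).lev du x z ≤ (fcellsA κ Φ t p O.merged (gOf κ Φ t p O (KS.gT 0 KS.gxAK)) (fOf κ Φ t p O (KS.fT 0 KS.fxA))).faceL du.1 j + (((KS.RlevA κ Φ t p O.merged 0 + KS.reachA t O.merged 0) : ℕ) : ℤ) → |z (oth du.1) - (fcellsA κ Φ t p O.merged (gOf κ Φ t p O (KS.gT 0 KS.gxAK)) (fOf κ Φ t p O (KS.fT 0 KS.fxA))).cen x (oth du.1)| ≤ ((prFA κ Φ t p O.merged (gOf κ Φ t p O (KS.gT 0 KS.gxAK)) (fOf κ Φ t p O (KS.fT 0 KS.fxA))).kFF₂ (fcellsA κ Φ t p O.merged (gOf κ Φ t p O (KS.gT 0 KS.gxAK)) (fOf κ Φ t p O (KS.fT 0 KS.fxA))) ((KS.RlevA κ Φ t p O.merged 0 + KS.reachA t O.merged 0) - 1) du.1) →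
      Skelφ.FloorsY2 (prFA κ Φ t p O.merged (gOf κ Φ t p O (KS.gT 0 KS.gxAK)) (fOf κ Φ t p O (KS.fT 0 KS.fxA))) (nL κ Φ t p O.merged (gOf κ Φ t p O (KS.gT 0 KS.gxAK)) (fOf κ Φ t p O (KS.fT 0 KS.fxA))) (((fcellsA κ Φ t p O.merged (gOf κ Φ t p O (KS.gT 0 KS.gxAK)) (fOf κ Φ t p O (KS.fT 0 KS.fxA))).s 0 : ℕ) : ℤ) (((fcellsA κ Φ t p O.merged (gOf κ Φ t p O (KS.gT 0 KS.gxAK)) (fOf κ Φ t p O (KS.fT 0 KS.fxA))).s 1 : ℕ) : ℤ) (modulus (nL κ Φ t p O.merged (gOf κ Φ t p O (KS.gT 0 KS.gxAK)) (fOf κ Φ t p O (KS.fT 0 KS.fxA))) (hL κ Φ t p O.merged (gOf κ Φ t p O (KS.gT 0 KS.gxAK)) (fOf κ Φ t p O (KS.fT 0 KS.fxA))) (vL κ Φ t p O.merged (gOf κ Φ t p O (KS.gT 0 KS.gxAK)) (fOf κ Φ t p O (KS.fT 0 KS.fxA))) (vβL κ Φ t p O.merged (gOf κ Φ t p O (KS.gT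 0 KS.gxAK)) (fOf κ Φ t p O (KS.fT 0 KS.fxA)))) (((nL κ Φ t p O.merged (gOf κ Φ t p O (KS.gT 0 KS.gxAK)) (fOf κ Φ t p O (KS.fT 0 KS.fxA))) : ℕ) : ℤ) (ℓL κ Φ t p O.merged (gOf κ Φ t p O (KS.gT 0 KS.gxAK)) (fOf κ Φ t p O (KS.fT 0 KS.fxA))) (fcellsA κ Φ t p O.merged (gOf κ Φ t p O (KS.gT 0 KS.gxAK)) (fOf κ Φ t p O (KS.fT 0 KS.fxA))) (b0TA κ Φ t p O.merged (gOf κ Φ t p O (KS.gT 0 KS.gxAK)) (fOf κ Φ t p O (KS.fT 0 KS.fxA))) x du j (3 : ℤ) (Skelφ.Prm.Lp (SUA exAFK mxRA κ Φ t p O.merged (gOf κ Φ t p O (KS.gT 0 KS.gxAK)) (fOf κ Φ t p O (KS.fT 0 KS.fxA)) q)) (Mu O.merged) z (fun i : Fin 2 => if i = 0 then KS.kF₀A κ Φ t p O.merged (cK κ) 0 (gOf κ Φ t p O (KS.gT 0 KS.gxAK)) (fOf κ Φ t p O (KS.fT 0 KS.fxA)) else KS.kF₁A κ Φ t p O.merged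 (cK κ) 0 (gOf κ Φ t p O (KS.gT 0 KS.gxAK)) (fOf κ Φ t p O (KS.fT 0 KS.fxA))) (σhF du) ((fun σ' : ℤ => KS.BFs κ Φ t p O.merged (cK κ) 0 (gOf κ Φ t p O (KS.gT 0 KS.gxAK)) (fOf κ Φ t p O (KS.fT 0 KS.fxA)) σ') (σhF du)) (KS.RA' κ Φ t p O.merged 0) qB' (KS.RA' κ Φ t p O.merged 0) qB₃' (yLF' x du j z) (NrF' x du j z) (N3F' x du j z) (σTF' x du j z)) ∧
        (∀ (x : Site 2) (du : MDir) (j : ℕ) (z : Site 2), NrF x du j z + N3F x du j z + 2 ≤ NegB.nFA κ.K₀) ∧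
        (∀ (x : Site 2) (du : MDir) (j : ℕ) (z : Site 2), NrF' x du j z + N3F' x du j z + 2 ≤ NegB.nFA κ.K₀) := by
  intro κ V _ _ G _ Φ t p hC O q hAt h1 hp0 hp1 hob
  have hN := eqNumL_of_atQOTA hAt
  have hκ := (clauseL_of_atQOTA hAt).2
  have eg : gOf κ Φ t p O (KS.gT 0 KS.gxAK) = KS.gT 0 (KS.gxA (cK κ)) κ Φ t p O.merged := KS.gT_gxAK κ Φ t p O.merged 0
  have ef : fOf κ Φ t p O (KS.fT 0 KS.fxA) = KS.fT 0 KS.fxA κ Φ t p O.merged := rfl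
  rw [eg, ef] at hN hκ
  rw [eg, ef]
  obtain ⟨-, -, hS, -, -, -, hEu0, -, hkE1, -⟩ := KS.floorsX2_hyps_A κ Φ t p O.merged (cK κ) hN hκ
  obtain ⟨-, -, -, -, -, -, -, -, hEu1, -, hkE0, -, -⟩ := KS.floorsY2_hyps_A κ Φ t p O.merged (cK κ) hN hκ
  have hex := (hex_exAFK κ Φ t p O.merged (KS.gT 0 (KS.gxA (cK κ)) κ Φ t p O.merged) (KS.fT 0 KS.fxA κ Φ t p O.merged)).1
  have hr : ∀ X : ℕ, X + 1 ≤ exA κ Φ t p O.merged (KS.gT 0 (KS.gxA (cK κ)) κ Φ t p O.merged) (KS.fT 0 KS.fxA κ Φ t p O.merged) → X ≤ Skelφ.Prm.Lp (SUA exAFK mxRA κ Φ t p O.merged (KS.gT 0 (KS.gxA (cK κ)) κ Φ t p O.merged) (KS.fT 0 KS.fxA κ Φ t p O.merged) q) := by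
    intro X hX; rw [Lp_SUA_eq]
    have e : exAFK κ Φ t p O.merged (KS.gT 0 (KS.gxA (cK κ)) κ Φ t p O.merged) (KS.fT 0 KS.fxA κ Φ t p O.merged) = exAFK κ Φ t p O.merged (KS.gT 0 (KS.gxA (cK κ)) κ Φ t p O.merged) (KS.fT 0 KS.fxA κ Φ t p O.merged) := rfl
    omega
  have hc : 600 * Neg.Kq κ ≤ cK κ := by rw [(cK_eq κ).1]; omega
  have hq := Neg.one_le_Kq κ
  refine ⟨fun du => if 0 ≤ vL κ Φ t p O.merged (KS.gT 0 (KS.gxA (cK κ)) κ Φ t p O.merged) (KS.fT 0 KS.fxA κ Φ t p O.merged) then sgOf du else -sgOf du, fun du => (KS.hopY_facts κ Φ t p O.merged (KS.gT 0 (KS.gxA (cK κ)) κ Φ t p O.merged) (KS.fT 0 KS.fxA κ Φ t p O.merged) du).1,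
    KS.qBXFs κ Φ t p O.merged 0, KS.qB3XA κ Φ t p O.merged (KS.gT 0 (KS.gxA (cK κ)) κ Φ t p O.merged) (KS.fT 0 KS.fxA κ Φ t p O.merged) (KS.RA' κ Φ t p O.merged 0),
    KS.qBF κ Φ t p O.merged (cK κ) 0 (KS.gT 0 (KS.gxA (cK κ)) κ Φ t p O.merged) (KS.fT 0 KS.fxA κ Φ t p O.merged), KS.qB3YA κ Φ t p O.merged (KS.gT 0 (KS.gxA (cK κ)) κ Φ t p O.merged) (KS.fT 0 KS.fxA κ Φ t p O.merged) (KS.RA' κ Φ t p O.merged 0),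
    fun x du j z => (KS.yLXFs κ Φ t p O.merged (cK κ) 0 (KS.gT 0 (KS.gxA (cK κ)) κ Φ t p O.merged) (KS.fT 0 KS.fxA κ Φ t p O.merged) (sgOf du)),
    fun x du j z => min (KS.NrX κ Φ t p O.merged (KS.gT 0 (KS.gxA (cK κ)) κ Φ t p O.merged) (KS.fT 0 KS.fxA κ Φ t p O.merged) (KS.yLXFs κ Φ t p O.merged (cK κ) 0 (KS.gT 0 (KS.gxA (cK κ)) κ Φ t p O.merged) (KS.fT 0 KS.fxA κ Φ t p O.merged) (sgOf du)) (KS.σTX κ Φ t p O.merged (KS.gT 0 (KS.gxA (cK κ)) κ Φ t p O.merged) (KS.fT 0 KS.fxA κ Φ t p O.merged) (KS.yLXFs κ Φ t p O.merged (cK κ) 0 (KS.gT 0 (KS.gxA (cK κ)) κ Φ t p O.merged) (KS.fT 0 KS.fxA κ Φ t p O.merged) (sgOf du)) x z) x du z) (600 * Neg.Kq κ - 1),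
    fun x du j z => min (KS.N3X κ Φ t p O.merged (KS.gT 0 (KS.gxA (cK κ)) κ Φ t p O.merged) (KS.fT 0 KS.fxA κ Φ t p O.merged) (KS.yLXFs κ Φ t p O.merged (cK κ) 0 (KS.gT 0 (KS.gxA (cK κ)) κ Φ t p O.merged) (KS.fT 0 KS.fxA κ Φ t p O.merged) (sgOf du)) x z) (200 * Neg.Kq κ + 9),
    fun x du j z => KS.σTX κ Φ t p O.merged (KS.gT 0 (KS.gxA (cK κ)) κ Φ t p O.merged) (KS.fT 0 KS.fxA κ Φ t p O.merged) (KS.yLXFs κ Φ t p O.merged (cK κ) 0 (KS.gT 0 (KS.gxA (cK κ)) κ Φ t p O.merged) (KS.fT 0 KS.fxA κ Φ t p O.merged) (sgOf du)) x z,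
    fun x du j z => (KS.yLFs κ Φ t p O.merged (cK κ) 0 (KS.gT 0 (KS.gxA (cK κ)) κ Φ t p O.merged) (KS.fT 0 KS.fxA κ Φ t p O.merged) (sgOf du) (if 0 ≤ vL κ Φ t p O.merged (KS.gT 0 (KS.gxA (cK κ)) κ Φ t p O.merged) (KS.fT 0 KS.fxA κ Φ t p O.merged) then sgOf du else -sgOf du)),
    fun x du j z => min (KS.NrY κ Φ t p O.merged (KS.gT 0 (KS.gxA (cK κ)) κ Φ t p O.merged) (KS.fT 0 KS.fxA κ Φ t p O.merged) (KS.yLFs κ Φ t p O.merged (cK κ) 0 (KS.gT 0 (KS.gxA (cK κ)) κ Φ t p O.merged) (KS.fT 0 KS.fxA κ Φ t p O.merged) (sgOf du) (if 0 ≤ vL κ Φ t p O.merged (KS.gT 0 (KS.gxA (cK κ)) κ Φ t p O.merged) (KS.fT 0 KS.fxA κ Φ t p O.merged) then sgOf du else -sgOf du)) x du z) (600 * Neg.Kq κ - 1),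
    fun x du j z => min (KS.N3Y κ Φ t p O.merged (KS.gT 0 (KS.gxA (cK κ)) κ Φ t p O.merged) (KS.fT 0 KS.fxA κ Φ t p O.merged) (KS.yLFs κ Φ t p O.merged (cK κ) 0 (KS.gT 0 (KS.gxA (cK κ)) κ Φ t p O.merged) (KS.fT 0 KS.fxA κ Φ t p O.merged) (sgOf du) (if 0 ≤ vL κ Φ t p O.merged (KS.gT 0 (KS.gxA (cK κ)) κ Φ t p O.merged) (KS.fT 0 KS.fxA κ Φ t p O.merged) then sgOf du else -sgOf du)) x z) (200 * Neg.Kq κ + 9),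
    fun x du j z => KS.σTY κ Φ t p O.merged (KS.gT 0 (KS.gxA (cK κ)) κ Φ t p O.merged) (KS.fT 0 KS.fxA κ Φ t p O.merged) (KS.yLFs κ Φ t p O.merged (cK κ) 0 (KS.gT 0 (KS.gxA (cK κ)) κ Φ t p O.merged) (KS.fT 0 KS.fxA κ Φ t p O.merged) (sgOf du) (if 0 ≤ vL κ Φ t p O.merged (KS.gT 0 (KS.gxA (cK κ)) κ Φ t p O.merged) (KS.fT 0 KS.fxA κ Φ t p O.merged) then sgOf du else -sgOf du)) x z, ?_, ?_, ?_, ?_⟩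
  · intro x du j z hd hj hlev1 hlev2 hz
    obtain ⟨i, sδ⟩ := du
    change i = 0 at hd
    subst hd
    obtain ⟨hNr, hN3⟩ := KS.rangesX_XFs κ Φ t p O.merged (cK κ) 0 (KS.gxA (cK κ)) KS.fxA hN hκ hS x ((0 : Fin 2), sδ) rfl j hj z hlev1 hlev2 hz hEu0 hkE1
    have e1 := min_eq_left (show KS.NrX κ Φ t p O.merged (KS.gT 0 (KS.gxA (cK κ)) κ Φ t p O.merged) (KS.fT 0 KS.fxA κ Φ t p O.merged) (KS.yLXFs κ Φ t p O.merged (cK κ) 0 (KS.gT 0 (KS.gxA (cK κ)) κ Φ t p O.merged) (KS.fT 0 KS.fxA κ Φ t p O.merged) (sgOf ((0 : Fin 2), sδ))) (KS.σTX κ Φ t p O.merged (KS.gT 0 (KS.gxA (cK κ)) κ Φ t p O.merged) (KS.fT 0 KS.fxA κ Φ t p O.merged) (KS.yLXFs κ Φ t p O.merged (cK κ) 0 (KS.gT 0 (KS.gxA (cK κ)) κ Φ t p O.merged) (KS.fT 0 KS.fxA κ Φ t p O.merged) (sgOf ((0 : Fin 2), sδ))) x z) x ((0 : Fin 2), sδ)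 z ≤ 600 * Neg.Kq κ - 1 by omega)
    have e2 := min_eq_left (show KS.N3X κ Φ t p O.merged (KS.gT 0 (KS.gxA (cK κ)) κ Φ t p O.merged) (KS.fT 0 KS.fxA κ Φ t p O.merged) (KS.yLXFs κ Φ t p O.merged (cK κ) 0 (KS.gT 0 (KS.gxA (cK κ)) κ Φ t p O.merged) (KS.fT 0 KS.fxA κ Φ t p O.merged) (sgOf ((0 : Fin 2), sδ))) x z ≤ 200 * Neg.Kq κ + 9 by omega)
    simp only [e1, e2]
    exact KS.floorsX_XFs_A κ Φ t p O.merged (cK κ) hN hκ _ hr x ((0 : Fin 2), sδ) j z rfl hj hlev1 hlev2 hz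
  · intro x du j z hd hj hlev1 hlev2 hz
    obtain ⟨i, sδ⟩ := du
    change i = 1 at hd
    subst hd
    obtain ⟨hNr, hN3⟩ := KS.rangesY_YFs κ Φ t p O.merged (cK κ) 0 (KS.gxA (cK κ)) KS.fxA hN hκ hS x ((1 : Fin 2), sδ) rfl j hj z hlev1 hlev2 hz hEu1 hkE0 _ (KS.hopY_facts κ Φ t p O.merged (KS.gT 0 (KS.gxA (cK κ)) κ Φ t p O.merged) (KS.fT 0 KS.fxA κ Φ t p O.merged) ((1 : Fin 2), sδ)).1
    have e1 := min_eq_left (show KS.NrY κ Φ t p O.merged (KS.gT 0 (KS.gxA (cK κ)) κ Φ t p O.merged) (KS.fT 0 KS.fxA κ Φ t p O.merged) (KS.yLFs κ Φ t p O.merged (cK κ) 0 (KS.gT 0 (KS.gxA (cK κ)) κ Φ t p O.merged) (KS.fT 0 KS.fxA κ Φ t p O.merged) (sgOf ((1 : Fin 2), sδ)) (if 0 ≤ vL κ Φ t p O.merged (KS.gT 0 (KS.gxA (cK κ)) κ Φ t p O.merged) (KS.fT 0 KS.fxA κ Φ t p O.merged) then sgOf ((1 : Fin 2), sδ) else -sgOf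 ((1 : Fin 2), sδ))) x ((1 : Fin 2), sδ) z ≤ 600 * Neg.Kq κ - 1 by omega)
    have e2 := min_eq_left (show KS.N3Y κ Φ t p O.merged (KS.gT 0 (KS.gxA (cK κ)) κ Φ t p O.merged) (KS.fT 0 KS.fxA κ Φ t p O.merged) (KS.yLFs κ Φ t p O.merged (cK κ) 0 (KS.gT 0 (KS.gxA (cK κ)) κ Φ t p O.merged) (KS.fT 0 KS.fxA κ Φ t p O.merged) (sgOf ((1 : Fin 2), sδ)) (if 0 ≤ vL κ Φ t p O.merged (KS.gT 0 (KS.gxA (cK κ)) κ Φ t p O.merged) (KS.fT 0 KS.fxA κ Φ t p O.merged) then sgOf ((1 : Fin 2), sδ) else -sgOf ((1 : Fin 2), sδ))) x z ≤ 200 * Neg.Kq κ + 9 by omega)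
    simp only [e1, e2]
    exact KS.floorsY_YFs_A κ Φ t p O.merged (cK κ) hN hκ hc _ hr x ((1 : Fin 2), sδ) j z rfl hj hlev1 hlev2 hz
  · intro x du j z
    have a := min_le_right (KS.NrX κ Φ t p O.merged (KS.gT 0 (KS.gxA (cK κ)) κ Φ t p O.merged) (KS.fT 0 KS.fxA κ Φ t p O.merged) (KS.yLXFs κ Φ t p O.merged (cK κ) 0 (KS.gT 0 (KS.gxA (cK κ)) κ Φ t p O.merged) (KS.fT 0 KS.fxA κ Φ t p O.merged) (sgOf du)) (KS.σTX κ Φ t p O.merged (KS.gT 0 (KS.gxA (cK κ)) κ Φ t p O.merged) (KS.fT 0 KS.fxA κ Φ t p O.merged) (KS.yLXFs κ Φ t p O.merged (cK κ) 0 (KS.gT 0 (KS.gxA (cK κ)) κ Φ t p O.merged) (KS.fT 0 KS.fxA κ Φ t p O.merged) (sgOf du)) x z) x du z) (600 * Neg.Kq κ - 1)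
    have b := min_le_right (KS.N3X κ Φ t p O.merged (KS.gT 0 (KS.gxA (cK κ)) κ Φ t p O.merged) (KS.fT 0 KS.fxA κ Φ t p O.merged) (KS.yLXFs κ Φ t p O.merged (cK κ) 0 (KS.gT 0 (KS.gxA (cK κ)) κ Φ t p O.merged) (KS.fT 0 KS.fxA κ Φ t p O.merged) (sgOf du)) x z) (200 * Neg.Kq κ + 9)
    exact (KS.capY_of_ranges κ (Nr := min _ (600 * Neg.Kq κ - 1)) (N₃ := min _ (200 * Neg.Kq κ + 9)) (by omega) (by omega)).1
  · intro x du j z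
    have a := min_le_right (KS.NrY κ Φ t p O.merged (KS.gT 0 (KS.gxA (cK κ)) κ Φ t p O.merged) (KS.fT 0 KS.fxA κ Φ t p O.merged) (KS.yLFs κ Φ t p O.merged (cK κ) 0 (KS.gT 0 (KS.gxA (cK κ)) κ Φ t p O.merged) (KS.fT 0 KS.fxA κ Φ t p O.merged) (sgOf du) (if 0 ≤ vL κ Φ t p O.merged (KS.gT 0 (KS.gxA (cK κ)) κ Φ t p O.merged) (KS.fT 0 KS.fxA κ Φ t p O.merged) then sgOf du else -sgOf du)) x du z) (600 * Neg.Kq κ - 1)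
    have b := min_le_right (KS.N3Y κ Φ t p O.merged (KS.gT 0 (KS.gxA (cK κ)) κ Φ t p O.merged) (KS.fT 0 KS.fxA κ Φ t p O.merged) (KS.yLFs κ Φ t p O.merged (cK κ) 0 (KS.gT 0 (KS.gxA (cK κ)) κ Φ t p O.merged) (KS.fT 0 KS.fxA κ Φ t p O.merged) (sgOf du) (if 0 ≤ vL κ Φ t p O.merged (KS.gT 0 (KS.gxA (cK κ)) κ Φ t p O.merged) (KS.fT 0 KS.fxA κ Φ t p O.merged) then sgOf du else -sgOf du)) x z) (200 * Neg.Kq κ + 9)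
    exact (KS.capY_of_ranges κ (Nr := min _ (600 * Neg.Kq κ - 1)) (N₃ := min _ (200 * Neg.Kq κ + 9)) (by omega) (by omega)).1

set_option maxHeartbeats 4000000 in
/-- **`FloorsD` at the K-slots** — the steep transposed bridge case (`ℓBF < 2|hBF|`, frames `KS.BFd`). [cite: KozmaNitzan2024, §4 Lemma 11–12 (pp. 21–25), Theorem 6 (pp. 25–31)] -/
theorem floorsPkgD_AK :
    ∀ (κ : Consts) {V : Type} [DecidableEq V] [Countable V] {G : SimpleGraph V} [G.LocallyFinite] (Φ : PlanarSkeletonNeg G) (t : V) (p : unitInterval)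
      (hC : Φ.CylSubcritical p) (O : Skelφ.StepI.OutO V) (q : unitInterval),
      (choiceAtOTA κ Φ t p (KS.gT 0 KS.gxAK) (KS.fT 0 KS.fxA) (SUA exAFK mxRA) hC (KS.PR 0 KS.PxFK)).AtQO O q → Φ.types = {t} → 0 < (p : ℝ) → (p : ℝ) < 1 →
      oriφ Φ.φ (O.ori t (KS.MBF κ Φ t p O.merged (cK κ) 0) (KS.nBF κ Φ t p O.merged (cK κ) 0)) = trφ (φL κ Φ t p O.D O.DT O.ori (gOf κ Φ t p O (KS.gT 0 KS.gxAK)) (fOf κ Φ t p O (KS.fT 0 KS.fxA))) → (KS.ℓBF κ Φ t p O.merged (cK κ) 0) < 2 * (KS.hBF κ Φ t p O.merged (cK κ) 0).natAbs →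
      ∃ (σhF : MDir → ℤ) (_ : ∀ du : MDir, σhF du = 1 ∨ σhF du = -1) (qB qB₃ qB' qB₃' : ℕ)
        (yLF : Site 2 → MDir → ℕ → Site 2 → Site 2) (NrF N3F : Site 2 → MDir → ℕ → Site 2 → ℕ) (σTF : Site 2 → MDir → ℕ → Site 2 → ℤ)
        (yLF' : Site 2 → MDir → ℕ → Site 2 → Site 2) (NrF' N3F' : Site 2 → MDir → ℕ → Site 2 → ℕ) (σTF' : Site 2 → MDir → ℕ → Site 2 → ℤ),
        (∀ (x : Site 2) (du : MDir) (j : ℕ) (z : Site 2), du.1 = 0 → j < (fcellsA κ Φ t p O.merged (gOf κ Φ t p O (KS.gT 0 KS.gxAK)) (fOf κ Φ t p O (KS.fT 0 KS.fxA))).K → ((fcellsA κ Φ t p O.merged (gOf κ Φ t p O (KS.gT 0 KS.gxAK)) (fOf κ Φ t p O (KS.fT 0 KS.fxA))).faceL du.1 j : ℤ) - (((KS.RlevA κ Φ t p O.merged 0 + KS.reachA t O.merged 0) : ℕ) : ℤ) ≤ (fcellsA κ Φ t p O.merged (gOf κ Φ t p O (KS.gT 0 KS.gxAK)) (fOf κ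 Φ t p O (KS.fT 0 KS.fxA))).lev du x z →
      (fcellsA κ Φ t p O.merged (gOf κ Φ t p O (KS.gT 0 KS.gxAK)) (fOf κ Φ t p O (KS.fT 0 KS.fxA))).lev du x z ≤ (fcellsA κ Φ t p O.merged (gOf κ Φ t p O (KS.gT 0 KS.gxAK)) (fOf κ Φ t p O (KS.fT 0 KS.fxA))).faceL du.1 j + (((KS.RlevA κ Φ t p O.merged 0 + KS.reachA t O.merged 0) : ℕ) : ℤ) → |z (oth du.1) - (fcellsA κ Φ t p O.merged (gOf κ Φ t p O (KS.gT 0 KS.gxAK)) (fOf κ Φ t p O (KS.fT 0 KS.fxA))).cen x (oth du.1)| ≤ ((prFA κ Φ t p O.merged (gOf κ Φ t p O (KS.gT 0 KS.gxAK)) (fOf κ Φ t p O (KS.fT 0 KS.fxA))).kFF₂ (fcellsA κ Φ t p O.merged (gOf κ Φ t p O (KS.gT 0 KS.gxAK)) (fOf κ Φ t p O (KS.fT 0 KS.fxA))) ((KS.RlevA κ Φ t p O.merged 0 + KS.reachA t O.merged 0) - 1) du.1) →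
      Skelφ.FloorsX2 (prFA κ Φ t p O.merged (gOf κ Φ t p O (KS.gT 0 KS.gxAK)) (fOf κ Φ t p O (KS.fT 0 KS.fxA))) (nL κ Φ t p O.merged (gOf κ Φ t p O (KS.gT 0 KS.gxAK)) (fOf κ Φ t p O (KS.fT 0 KS.fxA))) (((fcellsA κ Φ t p O.merged (gOf κ Φ t p O (KS.gT 0 KS.gxAK)) (fOf κ Φ t p O (KS.fT 0 KS.fxA))).s 0 : ℕ) : ℤ) (((fcellsA κ Φ t p O.merged (gOf κ Φ t p O (KS.gT 0 KS.gxAK)) (fOf κ Φ t p O (KS.fT 0 KS.fxA))).s 1 : ℕ) : ℤ) (modulus (nL κ Φ t p O.merged (gOf κ Φ t p O (KS.gT 0 KS.gxAK)) (fOf κ Φ t p O (KS.fT 0 KS.fxA))) (hL κ Φ t p O.merged (gOf κ Φ t p O (KS.gT 0 KS.gxAK)) (fOf κ Φ t p O (KS.fT 0 KS.fxA))) (vL κ Φ t p O.merged (gOf κ Φ t p O (KS.gT 0 KS.gxAK)) (fOf κ Φ t p O (KS.fT 0 KS.fxA))) (vβL κ Φ t p O.merged (gOf κ Φ t p O (KS.gT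 0 KS.gxAK)) (fOf κ Φ t p O (KS.fT 0 KS.fxA)))) (((nL κ Φ t p O.merged (gOf κ Φ t p O (KS.gT 0 KS.gxAK)) (fOf κ Φ t p O (KS.fT 0 KS.fxA))) : ℕ) : ℤ) (ℓL κ Φ t p O.merged (gOf κ Φ t p O (KS.gT 0 KS.gxAK)) (fOf κ Φ t p O (KS.fT 0 KS.fxA))) (fcellsA κ Φ t p O.merged (gOf κ Φ t p O (KS.gT 0 KS.gxAK)) (fOf κ Φ t p O (KS.fT 0 KS.fxA))) (b0TA κ Φ t p O.merged (gOf κ Φ t p O (KS.gT 0 KS.gxAK)) (fOf κ Φ t p O (KS.fT 0 KS.fxA))) x du j (3 : ℤ) (Skelφ.Prm.Lp (SUA exAFK mxRA κ Φ t p O.merged (gOf κ Φ t p O (KS.gT 0 KS.gxAK)) (fOf κ Φ t p O (KS.fT 0 KS.fxA)) q)) (Mu O.merged) z (fun i : Fin 2 => if i = 0 then KS.kF₀A κ Φ t p O.merged (cK κ) 0 (gOf κ Φ t p O (KS.gT 0 KS.gxAK)) (fOf κ Φ t p O (KS.fT 0 KS.fxA)) else KS.kF₁A κ Φ t p O.merged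 (cK κ) 0 (gOf κ Φ t p O (KS.gT 0 KS.gxAK)) (fOf κ Φ t p O (KS.fT 0 KS.fxA))) ((fun σ' : ℤ => KS.BFd κ Φ t p O.merged (cK κ) 0 (gOf κ Φ t p O (KS.gT 0 KS.gxAK)) (fOf κ Φ t p O (KS.fT 0 KS.fxA)) σ') (sgOf du)) (KS.RA' κ Φ t p O.merged 0) qB (KS.RA' κ Φ t p O.merged 0) qB₃ (yLF x du j z) (NrF x du j z) (N3F x du j z) (σTF x du j z)) ∧
        (∀ (x : Site 2) (du : MDir) (j : ℕ) (z : Site 2), du.1 = 1 → j < (fcellsA κ Φ t p O.merged (gOf κ Φ t p O (KS.gT 0 KS.gxAK)) (fOf κ Φ t p O (KS.fT 0 KS.fxA))).K → ((fcellsA κ Φ t p O.merged (gOf κ Φ t p O (KS.gT 0 KS.gxAK)) (fOf κ Φ t p O (KS.fT 0 KS.fxA))).faceL du.1 j : ℤ) - (((KS.RlevA κ Φ t p O.merged 0 + KS.reachA t O.merged 0) : ℕ) : ℤ) ≤ (fcellsA κ Φ t p O.merged (gOf κ Φ t p O (KS.gT 0 KS.gxAK)) (fOf κ Φ t p O (KS.fT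 0 KS.fxA))).lev du x z →
      (fcellsA κ Φ t p O.merged (gOf κ Φ t p O (KS.gT 0 KS.gxAK)) (fOf κ Φ t p O (KS.fT 0 KS.fxA))).lev du x z ≤ (fcellsA κ Φ t p O.merged (gOf κ Φ t p O (KS.gT 0 KS.gxAK)) (fOf κ Φ t p O (KS.fT 0 KS.fxA))).faceL du.1 j + (((KS.RlevA κ Φ t p O.merged 0 + KS.reachA t O.merged 0) : ℕ) : ℤ) → |z (oth du.1) - (fcellsA κ Φ t p O.merged (gOf κ Φ t p O (KS.gT 0 KS.gxAK)) (fOf κ Φ t p O (KS.fT 0 KS.fxA))).cen x (oth du.1)| ≤ ((prFA κ Φ t p O.merged (gOf κ Φ t p O (KS.gT 0 KS.gxAK)) (fOf κ Φ t p O (KS.fT 0 KS.fxA))).kFF₂ (fcellsA κ Φ t p O.merged (gOf κ Φ t p O (KS.gT 0 KS.gxAK)) (fOf κ Φ t p O (KS.fT 0 KS.fxA))) ((KS.RlevA κ Φ t p O.merged 0 + KS.reachA t O.merged 0) - 1) du.1) →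
      Skelφ.FloorsY2 (prFA κ Φ t p O.merged (gOf κ Φ t p O (KS.gT 0 KS.gxAK)) (fOf κ Φ t p O (KS.fT 0 KS.fxA))) (nL κ Φ t p O.merged (gOf κ Φ t p O (KS.gT 0 KS.gxAK)) (fOf κ Φ t p O (KS.fT 0 KS.fxA))) (((fcellsA κ Φ t p O.merged (gOf κ Φ t p O (KS.gT 0 KS.gxAK)) (fOf κ Φ t p O (KS.fT 0 KS.fxA))).s 0 : ℕ) : ℤ) (((fcellsA κ Φ t p O.merged (gOf κ Φ t p O (KS.gT 0 KS.gxAK)) (fOf κ Φ t p O (KS.fT 0 KS.fxA))).s 1 : ℕ) : ℤ) (modulus (nL κ Φ t p O.merged (gOf κ Φ t p O (KS.gT 0 KS.gxAK)) (fOf κ Φ t p O (KS.fT 0 KS.fxA))) (hL κ Φ t p O.merged (gOf κ Φ t p O (KS.gT 0 KS.gxAK)) (fOf κ Φ t p O (KS.fT 0 KS.fxA))) (vL κ Φ t p O.merged (gOf κ Φ t p O (KS.gT 0 KS.gxAK)) (fOf κ Φ t p O (KS.fT 0 KS.fxA))) (vβL κ Φ t p O.merged (gOf κ Φ t p O (KS.gT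 0 KS.gxAK)) (fOf κ Φ t p O (KS.fT 0 KS.fxA)))) (((nL κ Φ t p O.merged (gOf κ Φ t p O (KS.gT 0 KS.gxAK)) (fOf κ Φ t p O (KS.fT 0 KS.fxA))) : ℕ) : ℤ) (ℓL κ Φ t p O.merged (gOf κ Φ t p O (KS.gT 0 KS.gxAK)) (fOf κ Φ t p O (KS.fT 0 KS.fxA))) (fcellsA κ Φ t p O.merged (gOf κ Φ t p O (KS.gT 0 KS.gxAK)) (fOf κ Φ t p O (KS.fT 0 KS.fxA))) (b0TA κ Φ t p O.merged (gOf κ Φ t p O (KS.gT 0 KS.gxAK)) (fOf κ Φ t p O (KS.fT 0 KS.fxA))) x du j (3 : ℤ) (Skelφ.Prm.Lp (SUA exAFK mxRA κ Φ t p O.merged (gOf κ Φ t p O (KS.gT 0 KS.gxAK)) (fOf κ Φ t p O (KS.fT 0 KS.fxA)) q)) (Mu O.merged) z (fun i : Fin 2 => if i = 0 then KS.kF₀A κ Φ t p O.merged (cK κ) 0 (gOf κ Φ t p O (KS.gT 0 KS.gxAK)) (fOf κ Φ t p O (KS.fT 0 KS.fxA)) else KS.kF₁A κ Φ t p O.merged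 (cK κ) 0 (gOf κ Φ t p O (KS.gT 0 KS.gxAK)) (fOf κ Φ t p O (KS.fT 0 KS.fxA))) (σhF du) ((fun σ' : ℤ => KS.BFd κ Φ t p O.merged (cK κ) 0 (gOf κ Φ t p O (KS.gT 0 KS.gxAK)) (fOf κ Φ t p O (KS.fT 0 KS.fxA)) σ') (σhF du)) (KS.RA' κ Φ t p O.merged 0) qB' (KS.RA' κ Φ t p O.merged 0) qB₃' (yLF' x du j z) (NrF' x du j z) (N3F' x du j z) (σTF' x du j z)) ∧
        (∀ (x : Site 2) (du : MDir) (j : ℕ) (z : Site 2), NrF x du j z + N3F x du j z + 2 ≤ NegB.nFA κ.K₀) ∧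
        (∀ (x : Site 2) (du : MDir) (j : ℕ) (z : Site 2), NrF' x du j z + N3F' x du j z + 2 ≤ NegB.nFA κ.K₀) := by
  intro κ V _ _ G _ Φ t p hC O q hAt h1 hp0 hp1 hob hst
  have hN := eqNumL_of_atQOTA hAt
  have hκ := (clauseL_of_atQOTA hAt).2
  have eg : gOf κ Φ t p O (KS.gT 0 KS.gxAK) = KS.gT 0 (KS.gxA (cK κ)) κ Φ t p O.merged := KS.gT_gxAK κ Φ t p O.merged 0
  have ef : fOf κ Φ t p O (KS.fT 0 KS.fxA) = KS.fT 0 KS.fxA κ Φ t p O.merged := rfl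
  rw [eg, ef] at hN hκ
  rw [eg, ef]
  have hEF := (clauseP_of_atQOTA hAt (KS.bridgeF_adm κ Φ t p O.merged (cK κ) 0).1 (KS.bridgeF_adm κ Φ t p O.merged (cK κ) 0).2).1
  have hℓb := KS.ℓBF_ge κ Φ t p O.merged (cK κ) 0 _ hEF
  obtain ⟨-, -, hS, -, -, -, hEu0, -, hkE1, -⟩ := KS.floorsX2_hyps_A κ Φ t p O.merged (cK κ) hN hκ
  obtain ⟨-, -, -, -, -, -, -, -, hEu1, -, hkE0, -, -⟩ := KS.floorsY2_hyps_A κ Φ t p O.merged (cK κ) hN hκ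
  have hex := (hex_exAFK κ Φ t p O.merged (KS.gT 0 (KS.gxA (cK κ)) κ Φ t p O.merged) (KS.fT 0 KS.fxA κ Φ t p O.merged)).1
  have hr : ∀ X : ℕ, X + 1 ≤ exA κ Φ t p O.merged (KS.gT 0 (KS.gxA (cK κ)) κ Φ t p O.merged) (KS.fT 0 KS.fxA κ Φ t p O.merged) → X ≤ Skelφ.Prm.Lp (SUA exAFK mxRA κ Φ t p O.merged (KS.gT 0 (KS.gxA (cK κ)) κ Φ t p O.merged) (KS.fT 0 KS.fxA κ Φ t p O.merged) q) := by
    intro X hX; rw [Lp_SUA_eq]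
    have e : exAFK κ Φ t p O.merged (KS.gT 0 (KS.gxA (cK κ)) κ Φ t p O.merged) (KS.fT 0 KS.fxA κ Φ t p O.merged) = exAFK κ Φ t p O.merged (KS.gT 0 (KS.gxA (cK κ)) κ Φ t p O.merged) (KS.fT 0 KS.fxA κ Φ t p O.merged) := rfl
    omega
  have hc : 600 * Neg.Kq κ ≤ cK κ := by rw [(cK_eq κ).1]; omega
  have hq := Neg.one_le_Kq κ
  refine ⟨fun du => if 0 ≤ vL κ Φ t p O.merged (KS.gT 0 (KS.gxA (cK κ)) κ Φ t p O.merged) (KS.fT 0 KS.fxA κ Φ t p O.merged) then sgOf du else -sgOf du, fun du => (KS.hopY_facts κ Φ t p O.merged (KS.gT 0 (KS.gxA (cK κ)) κ Φ t p O.merged) (KS.fT 0 KS.fxA κ Φ t p O.merged) du).1,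
    KS.qBXFd κ Φ t p O.merged (cK κ) 0, KS.qB3XA κ Φ t p O.merged (KS.gT 0 (KS.gxA (cK κ)) κ Φ t p O.merged) (KS.fT 0 KS.fxA κ Φ t p O.merged) (KS.RA' κ Φ t p O.merged 0),
    KS.qBF κ Φ t p O.merged (cK κ) 0 (KS.gT 0 (KS.gxA (cK κ)) κ Φ t p O.merged) (KS.fT 0 KS.fxA κ Φ t p O.merged), KS.qB3YA κ Φ t p O.merged (KS.gT 0 (KS.gxA (cK κ)) κ Φ t p O.merged) (KS.fT 0 KS.fxA κ Φ t p O.merged) (KS.RA' κ Φ t p O.merged 0),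
    fun x du j z => (KS.yLXFd κ Φ t p O.merged (cK κ) 0 (KS.gT 0 (KS.gxA (cK κ)) κ Φ t p O.merged) (KS.fT 0 KS.fxA κ Φ t p O.merged) (sgOf du)),
    fun x du j z => min (KS.NrX κ Φ t p O.merged (KS.gT 0 (KS.gxA (cK κ)) κ Φ t p O.merged) (KS.fT 0 KS.fxA κ Φ t p O.merged) (KS.yLXFd κ Φ t p O.merged (cK κ) 0 (KS.gT 0 (KS.gxA (cK κ)) κ Φ t p O.merged) (KS.fT 0 KS.fxA κ Φ t p O.merged) (sgOf du)) (KS.σTX κ Φ t p O.merged (KS.gT 0 (KS.gxA (cK κ)) κ Φ t p O.merged) (KS.fT 0 KS.fxA κ Φ t p O.merged) (KS.yLXFd κ Φ t p O.merged (cK κ) 0 (KS.gT 0 (KS.gxA (cK κ)) κ Φ t p O.merged) (KS.fT 0 KS.fxA κ Φ t p O.merged) (sgOf du)) x z) x du z) (600 * Neg.Kq κ - 1),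
    fun x du j z => min (KS.N3X κ Φ t p O.merged (KS.gT 0 (KS.gxA (cK κ)) κ Φ t p O.merged) (KS.fT 0 KS.fxA κ Φ t p O.merged) (KS.yLXFd κ Φ t p O.merged (cK κ) 0 (KS.gT 0 (KS.gxA (cK κ)) κ Φ t p O.merged) (KS.fT 0 KS.fxA κ Φ t p O.merged) (sgOf du)) x z) (200 * Neg.Kq κ + 9),
    fun x du j z => KS.σTX κ Φ t p O.merged (KS.gT 0 (KS.gxA (cK κ)) κ Φ t p O.merged) (KS.fT 0 KS.fxA κ Φ t p O.merged) (KS.yLXFd κ Φ t p O.merged (cK κ) 0 (KS.gT 0 (KS.gxA (cK κ)) κ Φ t p O.merged) (KS.fT 0 KS.fxA κ Φ t p O.merged) (sgOf du)) x z,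
    fun x du j z => (KS.yLFd κ Φ t p O.merged (cK κ) 0 (KS.gT 0 (KS.gxA (cK κ)) κ Φ t p O.merged) (KS.fT 0 KS.fxA κ Φ t p O.merged) (sgOf du) (if 0 ≤ vL κ Φ t p O.merged (KS.gT 0 (KS.gxA (cK κ)) κ Φ t p O.merged) (KS.fT 0 KS.fxA κ Φ t p O.merged) then sgOf du else -sgOf du)),
    fun x du j z => min (KS.NrY κ Φ t p O.merged (KS.gT 0 (KS.gxA (cK κ)) κ Φ t p O.merged) (KS.fT 0 KS.fxA κ Φ t p O.merged) (KS.yLFd κ Φ t p O.merged (cK κ) 0 (KS.gT 0 (KS.gxA (cK κ)) κ Φ t p O.merged) (KS.fT 0 KS.fxA κ Φ t p O.merged) (sgOf du) (if 0 ≤ vL κ Φ t p O.merged (KS.gT 0 (KS.gxA (cK κ)) κ Φ t p O.merged) (KS.fT 0 KS.fxA κ Φ t p O.merged) then sgOf du else -sgOf du)) x du z) (600 * Neg.Kq κ - 1),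
    fun x du j z => min (KS.N3Y κ Φ t p O.merged (KS.gT 0 (KS.gxA (cK κ)) κ Φ t p O.merged) (KS.fT 0 KS.fxA κ Φ t p O.merged) (KS.yLFd κ Φ t p O.merged (cK κ) 0 (KS.gT 0 (KS.gxA (cK κ)) κ Φ t p O.merged) (KS.fT 0 KS.fxA κ Φ t p O.merged) (sgOf du) (if 0 ≤ vL κ Φ t p O.merged (KS.gT 0 (KS.gxA (cK κ)) κ Φ t p O.merged) (KS.fT 0 KS.fxA κ Φ t p O.merged) then sgOf du else -sgOf du)) x z) (200 * Neg.Kq κ + 9),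
    fun x du j z => KS.σTY κ Φ t p O.merged (KS.gT 0 (KS.gxA (cK κ)) κ Φ t p O.merged) (KS.fT 0 KS.fxA κ Φ t p O.merged) (KS.yLFd κ Φ t p O.merged (cK κ) 0 (KS.gT 0 (KS.gxA (cK κ)) κ Φ t p O.merged) (KS.fT 0 KS.fxA κ Φ t p O.merged) (sgOf du) (if 0 ≤ vL κ Φ t p O.merged (KS.gT 0 (KS.gxA (cK κ)) κ Φ t p O.merged) (KS.fT 0 KS.fxA κ Φ t p O.merged) then sgOf du else -sgOf du)) x z, ?_, ?_, ?_, ?_⟩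
  · intro x du j z hd hj hlev1 hlev2 hz
    obtain ⟨i, sδ⟩ := du
    change i = 0 at hd
    subst hd
    obtain ⟨hNr, hN3⟩ := KS.rangesX_XFd κ Φ t p O.merged (cK κ) 0 (KS.gxA (cK κ)) KS.fxA hN hκ hS (by omega) x ((0 : Fin 2), sδ) rfl j hj z hlev1 hlev2 hz hEu0 hkE1
    have e1 := min_eq_left (show KS.NrX κ Φ t p O.merged (KS.gT 0 (KS.gxA (cK κ)) κ Φ t p O.merged) (KS.fT 0 KS.fxA κ Φ t p O.merged) (KS.yLXFd κ Φ t p O.merged (cK κ) 0 (KS.gT 0 (KS.gxA (cK κ)) κ Φ t p O.merged) (KS.fT 0 KS.fxA κ Φ t p O.merged) (sgOf ((0 : Fin 2), sδ))) (KS.σTX κ Φ t p O.merged (KS.gT 0 (KS.gxA (cK κ)) κ Φ t p O.merged) (KS.fT 0 KS.fxA κ Φ t p O.merged) (KS.yLXFd κ Φ t p O.merged (cK κ) 0 (KS.gT 0 (KS.gxA (cK κ)) κ Φ t p O.merged) (KS.fT 0 KS.fxA κ Φ t p O.merged) (sgOf ((0 : Fin 2), sδ))) x z) x ((0 : Fin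 2), sδ) z ≤ 600 * Neg.Kq κ - 1 by omega)
    have e2 := min_eq_left (show KS.N3X κ Φ t p O.merged (KS.gT 0 (KS.gxA (cK κ)) κ Φ t p O.merged) (KS.fT 0 KS.fxA κ Φ t p O.merged) (KS.yLXFd κ Φ t p O.merged (cK κ) 0 (KS.gT 0 (KS.gxA (cK κ)) κ Φ t p O.merged) (KS.fT 0 KS.fxA κ Φ t p O.merged) (sgOf ((0 : Fin 2), sδ))) x z ≤ 200 * Neg.Kq κ + 9 by omega)
    simp only [e1, e2]
    exact KS.floorsX_XFd_A κ Φ t p O.merged (cK κ) hN hκ hst hℓb _ hr x ((0 : Fin 2), sδ) j z rfl hj hlev1 hlev2 hz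
  · intro x du j z hd hj hlev1 hlev2 hz
    obtain ⟨i, sδ⟩ := du
    change i = 1 at hd
    subst hd
    obtain ⟨hNr, hN3⟩ := KS.rangesY_YFd κ Φ t p O.merged (cK κ) 0 (KS.gxA (cK κ)) KS.fxA hN hκ hS x ((1 : Fin 2), sδ) rfl j hj z hlev1 hlev2 hz hEu1 hkE0 _ (KS.hopY_facts κ Φ t p O.merged (KS.gT 0 (KS.gxA (cK κ)) κ Φ t p O.merged) (KS.fT 0 KS.fxA κ Φ t p O.merged) ((1 : Fin 2), sδ)).1
    have e1 := min_eq_left (show KS.NrY κ Φ t p O.merged (KS.gT 0 (KS.gxA (cK κ)) κ Φ t p O.merged) (KS.fT 0 KS.fxA κ Φ t p O.merged) (KS.yLFd κ Φ t p O.merged (cK κ) 0 (KS.gT 0 (KS.gxA (cK κ)) κ Φ t p O.merged) (KS.fT 0 KS.fxA κ Φ t p O.merged) (sgOf ((1 : Fin 2), sδ)) (if 0 ≤ vL κ Φ t p O.merged (KS.gT 0 (KS.gxA (cK κ)) κ Φ t p O.merged) (KS.fT 0 KS.fxA κ Φ t p O.merged) then sgOf ((1 : Fin 2), sδ) else -sgOf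 ((1 : Fin 2), sδ))) x ((1 : Fin 2), sδ) z ≤ 600 * Neg.Kq κ - 1 by omega)
    have e2 := min_eq_left (show KS.N3Y κ Φ t p O.merged (KS.gT 0 (KS.gxA (cK κ)) κ Φ t p O.merged) (KS.fT 0 KS.fxA κ Φ t p O.merged) (KS.yLFd κ Φ t p O.merged (cK κ) 0 (KS.gT 0 (KS.gxA (cK κ)) κ Φ t p O.merged) (KS.fT 0 KS.fxA κ Φ t p O.merged) (sgOf ((1 : Fin 2), sδ)) (if 0 ≤ vL κ Φ t p O.merged (KS.gT 0 (KS.gxA (cK κ)) κ Φ t p O.merged) (KS.fT 0 KS.fxA κ Φ t p O.merged) then sgOf ((1 : Fin 2), sδ) else -sgOf ((1 : Fin 2), sδ))) x z ≤ 200 * Neg.Kq κ + 9 by omega)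
    simp only [e1, e2]
    exact KS.floorsY_YFd_A κ Φ t p O.merged (cK κ) hN hκ hc hst hℓb _ hr x ((1 : Fin 2), sδ) j z rfl hj hlev1 hlev2 hz
  · intro x du j z
    have a := min_le_right (KS.NrX κ Φ t p O.merged (KS.gT 0 (KS.gxA (cK κ)) κ Φ t p O.merged) (KS.fT 0 KS.fxA κ Φ t p O.merged) (KS.yLXFd κ Φ t p O.merged (cK κ) 0 (KS.gT 0 (KS.gxA (cK κ)) κ Φ t p O.merged) (KS.fT 0 KS.fxA κ Φ t p O.merged) (sgOf du)) (KS.σTX κ Φ t p O.merged (KS.gT 0 (KS.gxA (cK κ)) κ Φ t p O.merged) (KS.fT 0 KS.fxA κ Φ t p O.merged) (KS.yLXFd κ Φ t p O.merged (cK κ) 0 (KS.gT 0 (KS.gxA (cK κ)) κ Φ t p O.merged) (KS.fT 0 KS.fxA κ Φ t p O.merged) (sgOf du)) x z) x du z) (600 * Neg.Kq κ - 1)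
    have b := min_le_right (KS.N3X κ Φ t p O.merged (KS.gT 0 (KS.gxA (cK κ)) κ Φ t p O.merged) (KS.fT 0 KS.fxA κ Φ t p O.merged) (KS.yLXFd κ Φ t p O.merged (cK κ) 0 (KS.gT 0 (KS.gxA (cK κ)) κ Φ t p O.merged) (KS.fT 0 KS.fxA κ Φ t p O.merged) (sgOf du)) x z) (200 * Neg.Kq κ + 9)
    exact (KS.capY_of_ranges κ (Nr := min _ (600 * Neg.Kq κ - 1)) (N₃ := min _ (200 * Neg.Kq κ + 9)) (by omega) (by omega)).1
  · intro x du j z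
    have a := min_le_right (KS.NrY κ Φ t p O.merged (KS.gT 0 (KS.gxA (cK κ)) κ Φ t p O.merged) (KS.fT 0 KS.fxA κ Φ t p O.merged) (KS.yLFd κ Φ t p O.merged (cK κ) 0 (KS.gT 0 (KS.gxA (cK κ)) κ Φ t p O.merged) (KS.fT 0 KS.fxA κ Φ t p O.merged) (sgOf du) (if 0 ≤ vL κ Φ t p O.merged (KS.gT 0 (KS.gxA (cK κ)) κ Φ t p O.merged) (KS.fT 0 KS.fxA κ Φ t p O.merged) then sgOf du else -sgOf du)) x du z) (600 * Neg.Kq κ - 1)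
    have b := min_le_right (KS.N3Y κ Φ t p O.merged (KS.gT 0 (KS.gxA (cK κ)) κ Φ t p O.merged) (KS.fT 0 KS.fxA κ Φ t p O.merged) (KS.yLFd κ Φ t p O.merged (cK κ) 0 (KS.gT 0 (KS.gxA (cK κ)) κ Φ t p O.merged) (KS.fT 0 KS.fxA κ Φ t p O.merged) (sgOf du) (if 0 ≤ vL κ Φ t p O.merged (KS.gT 0 (KS.gxA (cK κ)) κ Φ t p O.merged) (KS.fT 0 KS.fxA κ Φ t p O.merged) then sgOf du else -sgOf du)) x z) (200 * Neg.Kq κ + 9)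
    exact (KS.capY_of_ranges κ (Nr := min _ (600 * Neg.Kq κ - 1)) (N₃ := min _ (200 * Neg.Kq κ + 9)) (by omega) (by omega)).1

set_option maxHeartbeats 4000000 in
/-- **`FloorsT` at the K-slots** — the flat transposed bridge case (`2|hBF| ≤ ℓBF`, frames `KS.BFt`). [cite: KozmaNitzan2024, §4 Lemma 11–12 (pp. 21–25), Theorem 6 (pp. 25–31)] -/
theorem floorsPkgT_AK :
    ∀ (κ : Consts) {V : Type} [DecidableEq V] [Countable V] {G : SimpleGraph V} [G.LocallyFinite] (Φ : PlanarSkeletonNeg G) (t : V) (p : unitInterval)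
      (hC : Φ.CylSubcritical p) (O : Skelφ.StepI.OutO V) (q : unitInterval),
      (choiceAtOTA κ Φ t p (KS.gT 0 KS.gxAK) (KS.fT 0 KS.fxA) (SUA exAFK mxRA) hC (KS.PR 0 KS.PxFK)).AtQO O q → Φ.types = {t} → 0 < (p : ℝ) → (p : ℝ) < 1 →
      oriφ Φ.φ (O.ori t (KS.MBF κ Φ t p O.merged (cK κ) 0) (KS.nBF κ Φ t p O.merged (cK κ) 0)) = trφ (φL κ Φ t p O.D O.DT O.ori (gOf κ Φ t p O (KS.gT 0 KS.gxAK)) (fOf κ Φ t p O (KS.fT 0 KS.fxA))) → 2 * (KS.hBF κ Φ t p O.merged (cK κ) 0).natAbs ≤ (KS.ℓBF κ Φ t p O.merged (cK κ) 0) →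
      ∃ (σhF : MDir → ℤ) (_ : ∀ du : MDir, σhF du = 1 ∨ σhF du = -1) (qB qB₃ qB' qB₃' : ℕ)
        (yLF : Site 2 → MDir → ℕ → Site 2 → Site 2) (NrF N3F : Site 2 → MDir → ℕ → Site 2 → ℕ) (σTF : Site 2 → MDir → ℕ → Site 2 → ℤ)
        (yLF' : Site 2 → MDir → ℕ → Site 2 → Site 2) (NrF' N3F' : Site 2 → MDir → ℕ → Site 2 → ℕ) (σTF' : Site 2 → MDir → ℕ → Site 2 → ℤ),
        (∀ (x : Site 2) (du : MDir) (j : ℕ) (z : Site 2), du.1 = 0 → j < (fcellsA κ Φ t p O.merged (gOf κ Φ t p O (KS.gT 0 KS.gxAK)) (fOf κ Φ t p O (KS.fT 0 KS.fxA))).K → ((fcellsA κ Φ t p O.merged (gOf κ Φ t p O (KS.gT 0 KS.gxAK)) (fOf κ Φ t p O (KS.fT 0 KS.fxA))).faceL du.1 j : ℤ) - (((KS.RlevA κ Φ t p O.merged 0 + KS.reachA t O.merged 0) : ℕ) : ℤ) ≤ (fcellsA κ Φ t p O.merged (gOf κ Φ t p O (KS.gT 0 KS.gxAK)) (fOf κ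 Φ t p O (KS.fT 0 KS.fxA))).lev du x z →
      (fcellsA κ Φ t p O.merged (gOf κ Φ t p O (KS.gT 0 KS.gxAK)) (fOf κ Φ t p O (KS.fT 0 KS.fxA))).lev du x z ≤ (fcellsA κ Φ t p O.merged (gOf κ Φ t p O (KS.gT 0 KS.gxAK)) (fOf κ Φ t p O (KS.fT 0 KS.fxA))).faceL du.1 j + (((KS.RlevA κ Φ t p O.merged 0 + KS.reachA t O.merged 0) : ℕ) : ℤ) → |z (oth du.1) - (fcellsA κ Φ t p O.merged (gOf κ Φ t p O (KS.gT 0 KS.gxAK)) (fOf κ Φ t p O (KS.fT 0 KS.fxA))).cen x (oth du.1)| ≤ ((prFA κ Φ t p O.merged (gOf κ Φ t p O (KS.gT 0 KS.gxAK)) (fOf κ Φ t p O (KS.fT 0 KS.fxA))).kFF₂ (fcellsA κ Φ t p O.merged (gOf κ Φ t p O (KS.gT 0 KS.gxAK)) (fOf κ Φ t p O (KS.fT 0 KS.fxA))) ((KS.RlevA κ Φ t p O.merged 0 + KS.reachA t O.merged 0) - 1) du.1) →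
      Skelφ.FloorsX2 (prFA κ Φ t p O.merged (gOf κ Φ t p O (KS.gT 0 KS.gxAK)) (fOf κ Φ t p O (KS.fT 0 KS.fxA))) (nL κ Φ t p O.merged (gOf κ Φ t p O (KS.gT 0 KS.gxAK)) (fOf κ Φ t p O (KS.fT 0 KS.fxA))) (((fcellsA κ Φ t p O.merged (gOf κ Φ t p O (KS.gT 0 KS.gxAK)) (fOf κ Φ t p O (KS.fT 0 KS.fxA))).s 0 : ℕ) : ℤ) (((fcellsA κ Φ t p O.merged (gOf κ Φ t p O (KS.gT 0 KS.gxAK)) (fOf κ Φ t p O (KS.fT 0 KS.fxA))).s 1 : ℕ) : ℤ) (modulus (nL κ Φ t p O.merged (gOf κ Φ t p O (KS.gT 0 KS.gxAK)) (fOf κ Φ t p O (KS.fT 0 KS.fxA))) (hL κ Φ t p O.merged (gOf κ Φ t p O (KS.gT 0 KS.gxAK)) (fOf κ Φ t p O (KS.fT 0 KS.fxA))) (vL κ Φ t p O.merged (gOf κ Φ t p O (KS.gT 0 KS.gxAK)) (fOf κ Φ t p O (KS.fT 0 KS.fxA))) (vβL κ Φ t p O.merged (gOf κ Φ t p O (KS.gT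 0 KS.gxAK)) (fOf κ Φ t p O (KS.fT 0 KS.fxA)))) (((nL κ Φ t p O.merged (gOf κ Φ t p O (KS.gT 0 KS.gxAK)) (fOf κ Φ t p O (KS.fT 0 KS.fxA))) : ℕ) : ℤ) (ℓL κ Φ t p O.merged (gOf κ Φ t p O (KS.gT 0 KS.gxAK)) (fOf κ Φ t p O (KS.fT 0 KS.fxA))) (fcellsA κ Φ t p O.merged (gOf κ Φ t p O (KS.gT 0 KS.gxAK)) (fOf κ Φ t p O (KS.fT 0 KS.fxA))) (b0TA κ Φ t p O.merged (gOf κ Φ t p O (KS.gT 0 KS.gxAK)) (fOf κ Φ t p O (KS.fT 0 KS.fxA))) x du j (3 : ℤ) (Skelφ.Prm.Lp (SUA exAFK mxRA κ Φ t p O.merged (gOf κ Φ t p O (KS.gT 0 KS.gxAK)) (fOf κ Φ t p O (KS.fT 0 KS.fxA)) q)) (Mu O.merged) z (fun i : Fin 2 => if i = 0 then KS.kF₀A κ Φ t p O.merged (cK κ) 0 (gOf κ Φ t p O (KS.gT 0 KS.gxAK)) (fOf κ Φ t p O (KS.fT 0 KS.fxA)) else KS.kF₁A κ Φ t p O.merged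 (cK κ) 0 (gOf κ Φ t p O (KS.gT 0 KS.gxAK)) (fOf κ Φ t p O (KS.fT 0 KS.fxA))) ((fun σ' : ℤ => KS.BFt κ Φ t p O.merged (cK κ) 0 (gOf κ Φ t p O (KS.gT 0 KS.gxAK)) (fOf κ Φ t p O (KS.fT 0 KS.fxA)) σ') (sgOf du)) (KS.RA' κ Φ t p O.merged 0) qB (KS.RA' κ Φ t p O.merged 0) qB₃ (yLF x du j z) (NrF x du j z) (N3F x du j z) (σTF x du j z)) ∧
        (∀ (x : Site 2) (du : MDir) (j : ℕ) (z : Site 2), du.1 = 1 → j < (fcellsA κ Φ t p O.merged (gOf κ Φ t p O (KS.gT 0 KS.gxAK)) (fOf κ Φ t p O (KS.fT 0 KS.fxA))).K → ((fcellsA κ Φ t p O.merged (gOf κ Φ t p O (KS.gT 0 KS.gxAK)) (fOf κ Φ t p O (KS.fT 0 KS.fxA))).faceL du.1 j : ℤ) - (((KS.RlevA κ Φ t p O.merged 0 + KS.reachA t O.merged 0) : ℕ) : ℤ) ≤ (fcellsA κ Φ t p O.merged (gOf κ Φ t p O (KS.gT 0 KS.gxAK)) (fOf κ Φ t p O (KS.fT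 0 KS.fxA))).lev du x z →
      (fcellsA κ Φ t p O.merged (gOf κ Φ t p O (KS.gT 0 KS.gxAK)) (fOf κ Φ t p O (KS.fT 0 KS.fxA))).lev du x z ≤ (fcellsA κ Φ t p O.merged (gOf κ Φ t p O (KS.gT 0 KS.gxAK)) (fOf κ Φ t p O (KS.fT 0 KS.fxA))).faceL du.1 j + (((KS.RlevA κ Φ t p O.merged 0 + KS.reachA t O.merged 0) : ℕ) : ℤ) → |z (oth du.1) - (fcellsA κ Φ t p O.merged (gOf κ Φ t p O (KS.gT 0 KS.gxAK)) (fOf κ Φ t p O (KS.fT 0 KS.fxA))).cen x (oth du.1)| ≤ ((prFA κ Φ t p O.merged (gOf κ Φ t p O (KS.gT 0 KS.gxAK)) (fOf κ Φ t p O (KS.fT 0 KS.fxA))).kFF₂ (fcellsA κ Φ t p O.merged (gOf κ Φ t p O (KS.gT 0 KS.gxAK)) (fOf κ Φ t p O (KS.fT 0 KS.fxA))) ((KS.RlevA κ Φ t p O.merged 0 + KS.reachA t O.merged 0) - 1) du.1) →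
      Skelφ.FloorsY2 (prFA κ Φ t p O.merged (gOf κ Φ t p O (KS.gT 0 KS.gxAK)) (fOf κ Φ t p O (KS.fT 0 KS.fxA))) (nL κ Φ t p O.merged (gOf κ Φ t p O (KS.gT 0 KS.gxAK)) (fOf κ Φ t p O (KS.fT 0 KS.fxA))) (((fcellsA κ Φ t p O.merged (gOf κ Φ t p O (KS.gT 0 KS.gxAK)) (fOf κ Φ t p O (KS.fT 0 KS.fxA))).s 0 : ℕ) : ℤ) (((fcellsA κ Φ t p O.merged (gOf κ Φ t p O (KS.gT 0 KS.gxAK)) (fOf κ Φ t p O (KS.fT 0 KS.fxA))).s 1 : ℕ) : ℤ) (modulus (nL κ Φ t p O.merged (gOf κ Φ t p O (KS.gT 0 KS.gxAK)) (fOf κ Φ t p O (KS.fT 0 KS.fxA))) (hL κ Φ t p O.merged (gOf κ Φ t p O (KS.gT 0 KS.gxAK)) (fOf κ Φ t p O (KS.fT 0 KS.fxA))) (vL κ Φ t p O.merged (gOf κ Φ t p O (KS.gT 0 KS.gxAK)) (fOf κ Φ t p O (KS.fT 0 KS.fxA))) (vβL κ Φ t p O.merged (gOf κ Φ t p O (KS.gT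 0 KS.gxAK)) (fOf κ Φ t p O (KS.fT 0 KS.fxA)))) (((nL κ Φ t p O.merged (gOf κ Φ t p O (KS.gT 0 KS.gxAK)) (fOf κ Φ t p O (KS.fT 0 KS.fxA))) : ℕ) : ℤ) (ℓL κ Φ t p O.merged (gOf κ Φ t p O (KS.gT 0 KS.gxAK)) (fOf κ Φ t p O (KS.fT 0 KS.fxA))) (fcellsA κ Φ t p O.merged (gOf κ Φ t p O (KS.gT 0 KS.gxAK)) (fOf κ Φ t p O (KS.fT 0 KS.fxA))) (b0TA κ Φ t p O.merged (gOf κ Φ t p O (KS.gT 0 KS.gxAK)) (fOf κ Φ t p O (KS.fT 0 KS.fxA))) x du j (3 : ℤ) (Skelφ.Prm.Lp (SUA exAFK mxRA κ Φ t p O.merged (gOf κ Φ t p O (KS.gT 0 KS.gxAK)) (fOf κ Φ t p O (KS.fT 0 KS.fxA)) q)) (Mu O.merged) z (fun i : Fin 2 => if i = 0 then KS.kF₀A κ Φ t p O.merged (cK κ) 0 (gOf κ Φ t p O (KS.gT 0 KS.gxAK)) (fOf κ Φ t p O (KS.fT 0 KS.fxA)) else KS.kF₁A κ Φ t p O.merged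 (cK κ) 0 (gOf κ Φ t p O (KS.gT 0 KS.gxAK)) (fOf κ Φ t p O (KS.fT 0 KS.fxA))) (σhF du) ((fun σ' : ℤ => KS.BFt κ Φ t p O.merged (cK κ) 0 (gOf κ Φ t p O (KS.gT 0 KS.gxAK)) (fOf κ Φ t p O (KS.fT 0 KS.fxA)) σ') (σhF du)) (KS.RA' κ Φ t p O.merged 0) qB' (KS.RA' κ Φ t p O.merged 0) qB₃' (yLF' x du j z) (NrF' x du j z) (N3F' x du j z) (σTF' x du j z)) ∧
        (∀ (x : Site 2) (du : MDir) (j : ℕ) (z : Site 2), NrF x du j z + N3F x du j z + 2 ≤ NegB.nFA κ.K₀) ∧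
        (∀ (x : Site 2) (du : MDir) (j : ℕ) (z : Site 2), NrF' x du j z + N3F' x du j z + 2 ≤ NegB.nFA κ.K₀) := by
  intro κ V _ _ G _ Φ t p hC O q hAt h1 hp0 hp1 hob hst
  have hN := eqNumL_of_atQOTA hAt
  have hκ := (clauseL_of_atQOTA hAt).2
  have eg : gOf κ Φ t p O (KS.gT 0 KS.gxAK) = KS.gT 0 (KS.gxA (cK κ)) κ Φ t p O.merged := KS.gT_gxAK κ Φ t p O.merged 0
  have ef : fOf κ Φ t p O (KS.fT 0 KS.fxA) = KS.fT 0 KS.fxA κ Φ t p O.merged := rfl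
  rw [eg, ef] at hN hκ
  rw [eg, ef]
  have hEF := (clauseP_of_atQOTA hAt (KS.bridgeF_adm κ Φ t p O.merged (cK κ) 0).1 (KS.bridgeF_adm κ Φ t p O.merged (cK κ) 0).2).1
  have hℓb := KS.ℓBF_ge κ Φ t p O.merged (cK κ) 0 _ hEF
  obtain ⟨-, -, hS, -, -, -, hEu0, -, hkE1, -⟩ := KS.floorsX2_hyps_A κ Φ t p O.merged (cK κ) hN hκ
  obtain ⟨-, -, -, -, -, -, -, -, hEu1, -, hkE0, -, -⟩ := KS.floorsY2_hyps_A κ Φ t p O.merged (cK κ) hN hκ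
  have hex := (hex_exAFK κ Φ t p O.merged (KS.gT 0 (KS.gxA (cK κ)) κ Φ t p O.merged) (KS.fT 0 KS.fxA κ Φ t p O.merged)).1
  have hr : ∀ X : ℕ, X + 1 ≤ exA κ Φ t p O.merged (KS.gT 0 (KS.gxA (cK κ)) κ Φ t p O.merged) (KS.fT 0 KS.fxA κ Φ t p O.merged) → X ≤ Skelφ.Prm.Lp (SUA exAFK mxRA κ Φ t p O.merged (KS.gT 0 (KS.gxA (cK κ)) κ Φ t p O.merged) (KS.fT 0 KS.fxA κ Φ t p O.merged) q) := by
    intro X hX; rw [Lp_SUA_eq]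
    have e : exAFK κ Φ t p O.merged (KS.gT 0 (KS.gxA (cK κ)) κ Φ t p O.merged) (KS.fT 0 KS.fxA κ Φ t p O.merged) = exAFK κ Φ t p O.merged (KS.gT 0 (KS.gxA (cK κ)) κ Φ t p O.merged) (KS.fT 0 KS.fxA κ Φ t p O.merged) := rfl
    omega
  have hc : 600 * Neg.Kq κ ≤ cK κ := by rw [(cK_eq κ).1]; omega
  have hq := Neg.one_le_Kq κ
  refine ⟨fun du => if 0 ≤ vL κ Φ t p O.merged (KS.gT 0 (KS.gxA (cK κ)) κ Φ t p O.merged) (KS.fT 0 KS.fxA κ Φ t p O.merged) then sgOf du else -sgOf du, fun du => (KS.hopY_facts κ Φ t p O.merged (KS.gT 0 (KS.gxA (cK κ)) κ Φ t p O.merged) (KS.fT 0 KS.fxA κ Φ t p O.merged) du).1,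
    KS.qBXFt κ Φ t p O.merged (cK κ) 0, KS.qB3XA κ Φ t p O.merged (KS.gT 0 (KS.gxA (cK κ)) κ Φ t p O.merged) (KS.fT 0 KS.fxA κ Φ t p O.merged) (KS.RA' κ Φ t p O.merged 0),
    KS.qBF κ Φ t p O.merged (cK κ) 0 (KS.gT 0 (KS.gxA (cK κ)) κ Φ t p O.merged) (KS.fT 0 KS.fxA κ Φ t p O.merged), KS.qB3YA κ Φ t p O.merged (KS.gT 0 (KS.gxA (cK κ)) κ Φ t p O.merged) (KS.fT 0 KS.fxA κ Φ t p O.merged) (KS.RA' κ Φ t p O.merged 0),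
    fun x du j z => (KS.yLXFt κ Φ t p O.merged (cK κ) 0 (KS.gT 0 (KS.gxA (cK κ)) κ Φ t p O.merged) (KS.fT 0 KS.fxA κ Φ t p O.merged) (sgOf du)),
    fun x du j z => min (KS.NrX κ Φ t p O.merged (KS.gT 0 (KS.gxA (cK κ)) κ Φ t p O.merged) (KS.fT 0 KS.fxA κ Φ t p O.merged) (KS.yLXFt κ Φ t p O.merged (cK κ) 0 (KS.gT 0 (KS.gxA (cK κ)) κ Φ t p O.merged) (KS.fT 0 KS.fxA κ Φ t p O.merged) (sgOf du)) (KS.σTX κ Φ t p O.merged (KS.gT 0 (KS.gxA (cK κ)) κ Φ t p O.merged) (KS.fT 0 KS.fxA κ Φ t p O.merged) (KS.yLXFt κ Φ t p O.merged (cK κ) 0 (KS.gT 0 (KS.gxA (cK κ)) κ Φ t p O.merged) (KS.fT 0 KS.fxA κ Φ t p O.merged) (sgOf du)) x z) x du z) (600 * Neg.Kq κ - 1),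
    fun x du j z => min (KS.N3X κ Φ t p O.merged (KS.gT 0 (KS.gxA (cK κ)) κ Φ t p O.merged) (KS.fT 0 KS.fxA κ Φ t p O.merged) (KS.yLXFt κ Φ t p O.merged (cK κ) 0 (KS.gT 0 (KS.gxA (cK κ)) κ Φ t p O.merged) (KS.fT 0 KS.fxA κ Φ t p O.merged) (sgOf du)) x z) (200 * Neg.Kq κ + 9),
    fun x du j z => KS.σTX κ Φ t p O.merged (KS.gT 0 (KS.gxA (cK κ)) κ Φ t p O.merged) (KS.fT 0 KS.fxA κ Φ t p O.merged) (KS.yLXFt κ Φ t p O.merged (cK κ) 0 (KS.gT 0 (KS.gxA (cK κ)) κ Φ t p O.merged) (KS.fT 0 KS.fxA κ Φ t p O.merged) (sgOf du)) x z,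
    fun x du j z => (KS.yLFt κ Φ t p O.merged (cK κ) 0 (KS.gT 0 (KS.gxA (cK κ)) κ Φ t p O.merged) (KS.fT 0 KS.fxA κ Φ t p O.merged) (sgOf du) (if 0 ≤ vL κ Φ t p O.merged (KS.gT 0 (KS.gxA (cK κ)) κ Φ t p O.merged) (KS.fT 0 KS.fxA κ Φ t p O.merged) then sgOf du else -sgOf du)),
    fun x du j z => min (KS.NrY κ Φ t p O.merged (KS.gT 0 (KS.gxA (cK κ)) κ Φ t p O.merged) (KS.fT 0 KS.fxA κ Φ t p O.merged) (KS.yLFt κ Φ t p O.merged (cK κ) 0 (KS.gT 0 (KS.gxA (cK κ)) κ Φ t p O.merged) (KS.fT 0 KS.fxA κ Φ t p O.merged) (sgOf du) (if 0 ≤ vL κ Φ t p O.merged (KS.gT 0 (KS.gxA (cK κ)) κ Φ t p O.merged) (KS.fT 0 KS.fxA κ Φ t p O.merged) then sgOf du else -sgOf du)) x du z) (600 * Neg.Kq κ - 1),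
    fun x du j z => min (KS.N3Y κ Φ t p O.merged (KS.gT 0 (KS.gxA (cK κ)) κ Φ t p O.merged) (KS.fT 0 KS.fxA κ Φ t p O.merged) (KS.yLFt κ Φ t p O.merged (cK κ) 0 (KS.gT 0 (KS.gxA (cK κ)) κ Φ t p O.merged) (KS.fT 0 KS.fxA κ Φ t p O.merged) (sgOf du) (if 0 ≤ vL κ Φ t p O.merged (KS.gT 0 (KS.gxA (cK κ)) κ Φ t p O.merged) (KS.fT 0 KS.fxA κ Φ t p O.merged) then sgOf du else -sgOf du)) x z) (200 * Neg.Kq κ + 9),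
    fun x du j z => KS.σTY κ Φ t p O.merged (KS.gT 0 (KS.gxA (cK κ)) κ Φ t p O.merged) (KS.fT 0 KS.fxA κ Φ t p O.merged) (KS.yLFt κ Φ t p O.merged (cK κ) 0 (KS.gT 0 (KS.gxA (cK κ)) κ Φ t p O.merged) (KS.fT 0 KS.fxA κ Φ t p O.merged) (sgOf du) (if 0 ≤ vL κ Φ t p O.merged (KS.gT 0 (KS.gxA (cK κ)) κ Φ t p O.merged) (KS.fT 0 KS.fxA κ Φ t p O.merged) then sgOf du else -sgOf du)) x z, ?_, ?_, ?_, ?_⟩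
  · intro x du j z hd hj hlev1 hlev2 hz
    obtain ⟨i, sδ⟩ := du
    change i = 0 at hd
    subst hd
    obtain ⟨hNr, hN3⟩ := KS.rangesX_XFt κ Φ t p O.merged (cK κ) 0 (KS.gxA (cK κ)) KS.fxA hN hκ hS (by omega) x ((0 : Fin 2), sδ) rfl j hj z hlev1 hlev2 hz hEu0 hkE1
    have e1 := min_eq_left (show KS.NrX κ Φ t p O.merged (KS.gT 0 (KS.gxA (cK κ)) κ Φ t p O.merged) (KS.fT 0 KS.fxA κ Φ t p O.merged) (KS.yLXFt κ Φ t p O.merged (cK κ) 0 (KS.gT 0 (KS.gxA (cK κ)) κ Φ t p O.merged) (KS.fT 0 KS.fxA κ Φ t p O.merged) (sgOf ((0 : Fin 2), sδ))) (KS.σTX κ Φ t p O.merged (KS.gT 0 (KS.gxA (cK κ)) κ Φ t p O.merged) (KS.fT 0 KS.fxA κ Φ t p O.merged) (KS.yLXFt κ Φ t p O.merged (cK κ) 0 (KS.gT 0 (KS.gxA (cK κ)) κ Φ t p O.merged) (KS.fT 0 KS.fxA κ Φ t p O.merged) (sgOf ((0 : Fin 2), sδ))) x z) x ((0 : Fin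 2), sδ) z ≤ 600 * Neg.Kq κ - 1 by omega)
    have e2 := min_eq_left (show KS.N3X κ Φ t p O.merged (KS.gT 0 (KS.gxA (cK κ)) κ Φ t p O.merged) (KS.fT 0 KS.fxA κ Φ t p O.merged) (KS.yLXFt κ Φ t p O.merged (cK κ) 0 (KS.gT 0 (KS.gxA (cK κ)) κ Φ t p O.merged) (KS.fT 0 KS.fxA κ Φ t p O.merged) (sgOf ((0 : Fin 2), sδ))) x z ≤ 200 * Neg.Kq κ + 9 by omega)
    simp only [e1, e2]
    exact KS.floorsX_XFt_A κ Φ t p O.merged (cK κ) hN hκ hst hℓb _ hr x ((0 : Fin 2), sδ) j z rfl hj hlev1 hlev2 hz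
  · intro x du j z hd hj hlev1 hlev2 hz
    obtain ⟨i, sδ⟩ := du
    change i = 1 at hd
    subst hd
    obtain ⟨hNr, hN3⟩ := KS.rangesY_YFt κ Φ t p O.merged (cK κ) 0 (KS.gxA (cK κ)) KS.fxA hN hκ hS x ((1 : Fin 2), sδ) rfl j hj z hlev1 hlev2 hz hEu1 hkE0 _ (KS.hopY_facts κ Φ t p O.merged (KS.gT 0 (KS.gxA (cK κ)) κ Φ t p O.merged) (KS.fT 0 KS.fxA κ Φ t p O.merged) ((1 : Fin 2), sδ)).1
    have e1 := min_eq_left (show KS.NrY κ Φ t p O.merged (KS.gT 0 (KS.gxA (cK κ)) κ Φ t p O.merged) (KS.fT 0 KS.fxA κ Φ t p O.merged) (KS.yLFt κ Φ t p O.merged (cK κ) 0 (KS.gT 0 (KS.gxA (cK κ)) κ Φ t p O.merged) (KS.fT 0 KS.fxA κ Φ t p O.merged) (sgOf ((1 : Fin 2), sδ)) (if 0 ≤ vL κ Φ t p O.merged (KS.gT 0 (KS.gxA (cK κ)) κ Φ t p O.merged) (KS.fT 0 KS.fxA κ Φ t p O.merged) then sgOf ((1 : Fin 2), sδ) else -sgOf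 ((1 : Fin 2), sδ))) x ((1 : Fin 2), sδ) z ≤ 600 * Neg.Kq κ - 1 by omega)
    have e2 := min_eq_left (show KS.N3Y κ Φ t p O.merged (KS.gT 0 (KS.gxA (cK κ)) κ Φ t p O.merged) (KS.fT 0 KS.fxA κ Φ t p O.merged) (KS.yLFt κ Φ t p O.merged (cK κ) 0 (KS.gT 0 (KS.gxA (cK κ)) κ Φ t p O.merged) (KS.fT 0 KS.fxA κ Φ t p O.merged) (sgOf ((1 : Fin 2), sδ)) (if 0 ≤ vL κ Φ t p O.merged (KS.gT 0 (KS.gxA (cK κ)) κ Φ t p O.merged) (KS.fT 0 KS.fxA κ Φ t p O.merged) then sgOf ((1 : Fin 2), sδ) else -sgOf ((1 : Fin 2), sδ))) x z ≤ 200 * Neg.Kq κ + 9 by omega)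
    simp only [e1, e2]
    exact KS.floorsY_YFt_A κ Φ t p O.merged (cK κ) hN hκ hc hst hℓb _ hr x ((1 : Fin 2), sδ) j z rfl hj hlev1 hlev2 hz
  · intro x du j z
    have a := min_le_right (KS.NrX κ Φ t p O.merged (KS.gT 0 (KS.gxA (cK κ)) κ Φ t p O.merged) (KS.fT 0 KS.fxA κ Φ t p O.merged) (KS.yLXFt κ Φ t p O.merged (cK κ) 0 (KS.gT 0 (KS.gxA (cK κ)) κ Φ t p O.merged) (KS.fT 0 KS.fxA κ Φ t p O.merged) (sgOf du)) (KS.σTX κ Φ t p O.merged (KS.gT 0 (KS.gxA (cK κ)) κ Φ t p O.merged) (KS.fT 0 KS.fxA κ Φ t p O.merged) (KS.yLXFt κ Φ t p O.merged (cK κ) 0 (KS.gT 0 (KS.gxA (cK κ)) κ Φ t p O.merged) (KS.fT 0 KS.fxA κ Φ t p O.merged) (sgOf du)) x z) x du z) (600 * Neg.Kq κ - 1)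
    have b := min_le_right (KS.N3X κ Φ t p O.merged (KS.gT 0 (KS.gxA (cK κ)) κ Φ t p O.merged) (KS.fT 0 KS.fxA κ Φ t p O.merged) (KS.yLXFt κ Φ t p O.merged (cK κ) 0 (KS.gT 0 (KS.gxA (cK κ)) κ Φ t p O.merged) (KS.fT 0 KS.fxA κ Φ t p O.merged) (sgOf du)) x z) (200 * Neg.Kq κ + 9)
    exact (KS.capY_of_ranges κ (Nr := min _ (600 * Neg.Kq κ - 1)) (N₃ := min _ (200 * Neg.Kq κ + 9)) (by omega) (by omega)).1
  · intro x du j z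
    have a := min_le_right (KS.NrY κ Φ t p O.merged (KS.gT 0 (KS.gxA (cK κ)) κ Φ t p O.merged) (KS.fT 0 KS.fxA κ Φ t p O.merged) (KS.yLFt κ Φ t p O.merged (cK κ) 0 (KS.gT 0 (KS.gxA (cK κ)) κ Φ t p O.merged) (KS.fT 0 KS.fxA κ Φ t p O.merged) (sgOf du) (if 0 ≤ vL κ Φ t p O.merged (KS.gT 0 (KS.gxA (cK κ)) κ Φ t p O.merged) (KS.fT 0 KS.fxA κ Φ t p O.merged) then sgOf du else -sgOf du)) x du z) (600 * Neg.Kq κ - 1)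
    have b := min_le_right (KS.N3Y κ Φ t p O.merged (KS.gT 0 (KS.gxA (cK κ)) κ Φ t p O.merged) (KS.fT 0 KS.fxA κ Φ t p O.merged) (KS.yLFt κ Φ t p O.merged (cK κ) 0 (KS.gT 0 (KS.gxA (cK κ)) κ Φ t p O.merged) (KS.fT 0 KS.fxA κ Φ t p O.merged) (sgOf du) (if 0 ≤ vL κ Φ t p O.merged (KS.gT 0 (KS.gxA (cK κ)) κ Φ t p O.merged) (KS.fT 0 KS.fxA κ Φ t p O.merged) then sgOf du else -sgOf du)) x z) (200 * Neg.Kq κ + 9)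
    exact (KS.capY_of_ranges κ (Nr := min _ (600 * Neg.Kq κ - 1)) (N₃ := min _ (200 * Neg.Kq κ + 9)) (by omega) (by omega)).1

end NegB

end PlanarSkeletonNeg

end Summit.CriticalPhenomena.PercolationContinuityZ3.Theorems.Transplant

end
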